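import Summits.NavierStokesRegularity.NavierStokesRegularity.Theses.HodographBetchov
import Summits.NavierStokesRegularity.NavierStokesRegularity.Theorems.FastClassSqueeze.Negative.FalseWithoutLerayHopf
import Summits.NavierStokesRegularity.NavierStokesRegularity.Theorems.HodographBetchovEquivalence
import Literature.Analysis.FluidPDE.NSQuasipotential
import Literature.Analysis.FluidPDE.LerayGaugeStrainSpectrum
import Literature.Analysis.FluidPDE.TaoClassGlobal
import Literature.Analysis.FluidPDE.LerayLocalRegularH1Proofs
import Literature.Analysis.FluidPDE.VorticityCalculus
import Literature.Analysis.FluidPDE.VectorCalculusProofs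
import Literature.Analysis.FluidPDE.RusinSverakCompactnessProofs

/-!
# Disproof of `FastClassSqueeze` — findings (refuter crux-disprover, cycle 1, 2026-08-17, rev 5 — all four Negative/ files landed: p161450, p162593, p163546, p163882)

Crux stmt-NavierStokesRegularity-15832, `Theses.HodographBetchov.FastClassSqueeze` (route HodographBetchov,
rank 3): along every classical solution of unforced Navier–Stokes on `ℝ³ × [0,T)` that is Leray–Hopf
from a rapidly decaying datum there are a speed level `l > 0`, an exponent `q > 3/2` and a
nonnegative min–max majorant `m` of the middle strain eigenvalue on the fast class `{|u(t)| > l}` with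
`∫₀ᵀ (∫_{|u|>l} m^q)^{2/(2q−3)} dt < ∞`.

## Index of findings (provers: read §0 and §3 first)

* §0 **STATUS — no unconditional kill exists short of a Millennium counterexample.** The tree proves
  `NavierStokesRegularity → FastClassSqueeze` (`Theorems/HodographBetchovEquivalence.lean`,
  `fastClassSqueeze_of_navierStokesRegularity`, through `FastClassSqueeze.fastClassSqueeze_of_noBlowup`)
  and `NavierStokesRegularity ↔ SlowClassProduction ∧ FastClassSqueeze`. Recorded here as
  `not_clay_of_not_fastClassSqueeze` and, sharper, `exists_blowup_of_not_fastClassSqueeze` /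
  `exists_unbounded_of_not_fastClassSqueeze`: a refutation of the crux IS a classical Leray–Hopf flow
  from a rapidly decaying datum that does not extend past `T` and is unbounded on `[0,T) × ℝ³`, with
  fast-class `λ₂⁺` outside every Miller class. This is why the crux resists every cheap attack below.
* §1 **Load-bearing hypotheses.**
  - `IsLerayHopfOn` (finite energy) is load-bearing: LANDED `Negative/FalseWithoutLerayHopf.lean`
    (p150219, `fastClassSqueeze_false_without_lerayHopf`, biaxial strain flow from rest); re-exported
    as `fastClassSqueeze_false_without_lerayHopf'`. Remark: the witness is non-decaying; "L-H" can be
    weakened to "u(t) → 0 at spatial infinity uniformly on [0,T)" without becoming refutable (then the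
    fast class is bounded and only temporal blow-up can diverge the functional).
  - `0 < T` is NOT load-bearing (`fastClassSqueezeWithoutTpos_iff`: for `T ≤ 0` everything is empty).
  - `0 < ν`, `HasRapidSpatialDecay (u 0)`, `IsClassicalNSSolutionOn`: not attackable — each dropped
    version is again implied by a no-blow-up statement for the enlarged class (ν = 0: smooth Euler
    blow-up on ℝ³ open; ν < 0: needs an EXPLICIT finite-energy backward-NS blow-up, none known in
    closed form; no decay: datum is still `L² ∩ C^∞`; weak L-H only: a junk representative has
    `fderiv = 0` off differentiability points, so `m ≡ 0` works wherever the statement could be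
    cheated). Provers: none of these three hypotheses is visibly USED by the crux itself either —
    decay enters the route only through the hodograph identity in the bridge crux.
* §2 **Tightness of the side conditions.** `conclusion_junk_at_endpoint`: with `3/2 ≤ q` in place of
  `3/2 < q` the conclusion holds for EVERY field (`q = 3/2` makes the exponent `2/(2q−3) = 2/0 = 0`
  in Lean, the time integrand `1`): the strict inequality is exactly what keeps the statement honest.
  The min–max clause is honest (`m` cannot be `0` where `λ₂ > 0`, FalseWithoutLerayHopf (i)).
* §3 **Targets (the lead's registered stubs, skeleton sha 8cb8a8bd…, 12:32Z).**
  - `stub_pointSqueeze_of_subscale` is FALSE AS REGISTERED: `stub_pointSqueeze_of_subscale_false`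
    (this file, mirror of proposal p161450 → `Theorems/FastClassSqueeze/Negative/StubPointSqueezeOfSubscaleFalse.lean`).
    Negative-time junk: `τ` is ∀-quantified over ℝ, both functionals integrate over `Ioo τ T`, and no
    hypothesis constrains `u t` for `t < 0`. MISSTATED — repair: add `0 ≤ τ` (or `Ioo (max τ 0) T`);
    the repaired stub is the landed Weyl split B2 localised (true). Evidence note on the item 12:52Z.
  - `stub_pointSubscaleSqueeze` (∃ τ, the hard stub) and `stub_germ_of_pointSqueeze` (τ existential in
    the conclusion, hypothesis-side τ only strengthens the hypothesis): no junk handle; both are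
    vacuously true for flows without top singular points, hence irrefutable without a blow-up (§0).
    Junk audit of `IsBackwardSingularPoint u (T,x₀)`: large cylinders dip into `t < 0`, but the
    predicate quantifies over ALL radii, and small cylinders lie in `t > 0` — negative-time junk
    cannot create or destroy singular points. `R ≤ 0` / `r ≤ 0` / `τ ≥ T` make stub 2 trivially true
    (average over a null set is `0`, empty ball, empty interval), not false.
  - UPDATE 13:14Z: the lead re-registered the skeleton (sha c4aa99ce…) with the repair adopted — single
    stub `stub_pointSubscaleSqueeze` now carrying `0 ≤ τ ∧ τ < T`, plus the helper stub
    `pointSubscaleSqueeze_of_fastClassSqueezeWindow` (FCS-with-`q ≥ 3` ⇒ stub; true by Weyl/Minkowski,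
    `τ = 0`, `R = 1`). Junk audit of both: clean; neither is refutable without a blow-up (§0).
* §4 **Natural strengthenings** (prose; each is implied by no-blow-up, so none is refutable today):
  every-level form (`∀ l > 0` instead of `∃ l`), fixed exponent (`q = 2`), global-in-space Miller bound
  (`m` majorant on all of ℝ³), time-only majorant `M(t) ∈ L^r` (card chebyshev-sup-transfer, C⁺; it
  is already log-divergent at the self-similar rate). UNIFORM forms (constants depending only on data
  norms) are scale-invariant and cannot be killed by rescaling one global solution either.
* §5 **The conclusion is NOT kinematic** (`not_fastClassSqueezeKinematic`, CLOSED this cycle, sorry-free;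
  LANDED/landing as `Theorems/FastClassSqueeze/Negative/KinematicBlob.lean` (p162593 accepted, part 1) +
  `…/Negative/FalseKinematic.lean` (p163546 accepted, part 2, `fastClassSqueeze_false_kinematic`) +
  `…/Negative/FalseKinematicGradient.lean` (p163882 accepted, part 3, X₂ corollary)): the conclusion of
  the crux fails for a jointly smooth, divergence-free, compactly supported field with finite
  NON-INCREASING energy, FINITE total dissipation, the TYPE-I rate and a bounded critical norm
  `sup_t‖u(t)‖₃ < ∞` (ESS class; scale invariant for the witness) — the self-similar-rate
  collapsing blob `u(t,x) = λU(λx)`, `λ = (1−t)^{-1/2}`, `U = curl(χ·A) = diag(1,1,−2)x` on the unit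
  ball: energy `√(1−t)‖U‖₂² ↓`, dissipation `∫λ·‖∇U‖₂² < ∞`, `‖u‖_∞ ≤ ‖U‖_∞(1−t)^{-1/2}`, but on the
  fast biaxial core the min–max clause forces `m ≥ λ²`, the time integrand is `≥ K/(1−t)`, `∫ = ∞`.
  So any proof must use the momentum equation beyond the energy inequality (pressure / local energy
  flux through isotachs) and must exclude exactly the FAST BIAXIAL TYPE-I collapse; the self-similar
  rate is the first (logarithmically) divergent one.

BC2 split (strategist, 13:12Z–13:20Z): X₁ = `NoFastEnergyConcentration` (stmt-18118) and X₂ =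
`FastGradientSerrinStarved` (stmt-18120), glue `FastClassSqueezeOfSubs` (stmt-18129, proved). Junk
audit of both signatures: clean (times in `Ico 0 T` / `Ioo 0 T` only, `ofReal ε`, `ofReal ‖∇u‖ ^ q` with
`q > 3/2`); both are vacuously true for bounded flows, hence irrefutable without a blow-up (§0). §5
applies VERBATIM to X₂: the kinematic blob satisfies X₁'s conclusion (its total energy `√(1−t)‖U‖₂²`
tends to `0`, and before that the fast class above `sup|u|` is empty) while its fast-class GRADIENT
functional diverges exactly like the middle-strain one (`‖∇u‖ ≥ λ₂`), so X₂ — not X₁ — carries the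
regularity strength, and a proof of X₂ must be dynamic (it must exclude the fast biaxial Type-I collapse):
kernel-checked as `fastGradientSerrinStarved_false_kinematic` (§5; LANDED as
`…/Negative/FalseKinematicGradient.lean`, p163882).

Conjectural kill mechanism (not landable): Hou's 2022 interior axisymmetric scenario — axial inflow,
radial outflow at the collapsing ring = biaxial strain (λ₂ > 0) on the fastest fluid; if it is a true
blow-up transplantable to decaying data on ℝ³, the functional diverges and FCS fails with Clay (A).
-/

noncomputable section

-- the summit and its single problem share the name `NavierStokesRegularity` (D-0017 nested layout)
set_option linter.dupNamespace false

namespace Summit.NavierStokesRegularity.NavierStokesRegularity.Cruxes.FastClassSqueeze.Disproof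

open MeasureTheory Set Filter Metric Topology Function InnerProductSpace
open scoped ENNReal NNReal RealInnerProductSpace ContDiff
open Literature.Analysis.FluidPDE
open Summit.NavierStokesRegularity.NavierStokesRegularity.Theses.HodographBetchov
open Summit.NavierStokesRegularity.NavierStokesRegularity.Theorems.FastClassSqueeze.Negative

/-! ## §0 Status: a disproof of the crux is a disproof of Clay (A) -/

/-- **Refuting `FastClassSqueeze` refutes the Millennium statement** (tree:
`HodographBetchov.not_navierStokesRegularity_of_not_fastClassSqueeze`). [folklore] -/
theorem not_clay_of_not_fastClassSqueeze (h : ¬ FastClassSqueeze) : ¬ _root_.NavierStokesRegularity :=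
  Theorems.HodographBetchov.not_navierStokesRegularity_of_not_fastClassSqueeze h

/-- **A counterexample to the crux is a first-time blow-up**: if `FastClassSqueeze` fails, some
classical solution of unforced Navier–Stokes on `ℝ³ × [0,T)`, Leray–Hopf from its rapidly decaying
datum, does not extend classically past `T` (contrapositive of the tree's
`FastClassSqueeze.fastClassSqueeze_of_noBlowup`). [folklore] -/
theorem exists_blowup_of_not_fastClassSqueeze (h : ¬ FastClassSqueeze) :
    ∃ (ν T : ℝ), 0 < ν ∧ 0 < T ∧
      ∃ (u : ℝ → EuclideanSpace ℝ (Fin 3) → EuclideanSpace ℝ (Fin 3))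
        (p : ℝ → EuclideanSpace ℝ (Fin 3) → ℝ),
        IsClassicalNSSolutionOn (Set.Ico 0 T) ν 0 u p ∧ IsLerayHopfOn T ν 0 (u 0) u ∧
          HasRapidSpatialDecay (u 0) ∧ ¬ HasSmoothExtensionPast ν 0 u T := by
  by_contra hne
  push Not at hne
  exact h (Theorems.FastClassSqueeze.fastClassSqueeze_of_noBlowup
    fun ν T hν hT u p hcl hLH hdec => hne ν T hν hT u p hcl hLH hdec)

/-- **A counterexample to the crux is unbounded on `[0,T) × ℝ³`** (contrapositive of the tree's
`FastClassSqueeze.conclusion_of_bounded`: for a bounded field the fast class above `sup |u|` is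
empty and the conclusion is trivial). [folklore] -/
theorem exists_unbounded_of_not_fastClassSqueeze (h : ¬ FastClassSqueeze) :
    ∃ (ν T : ℝ), 0 < ν ∧ 0 < T ∧
      ∃ (u : ℝ → EuclideanSpace ℝ (Fin 3) → EuclideanSpace ℝ (Fin 3))
        (p : ℝ → EuclideanSpace ℝ (Fin 3) → ℝ),
        IsClassicalNSSolutionOn (Set.Ico 0 T) ν 0 u p ∧ IsLerayHopfOn T ν 0 (u 0) u ∧
          HasRapidSpatialDecay (u 0) ∧ ∀ L : ℝ, ∃ t ∈ Set.Ico 0 T, ∃ x, L < ‖u t x‖ := by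
  by_contra hne
  push Not at hne
  refine h fun ν T hν hT u p hcl hLH hdec => ?_
  obtain ⟨L, hL⟩ := hne ν T hν hT u p hcl hLH hdec
  exact Theorems.FastClassSqueeze.conclusion_of_bounded T u L hL

/-! ## §1 Load-bearing hypotheses -/

/-- The crux with the Leray–Hopf (finite-energy) hypothesis deleted and nothing else changed. -/
def FastClassSqueezeWithoutLerayHopf : Prop :=
  ∀ (ν T : ℝ), 0 < ν → 0 < T →
    ∀ (u : ℝ → EuclideanSpace ℝ (Fin 3) → EuclideanSpace ℝ (Fin 3))
      (p : ℝ → EuclideanSpace ℝ (Fin 3) → ℝ),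
      IsClassicalNSSolutionOn (Set.Ico 0 T) ν 0 u p → HasRapidSpatialDecay (u 0) →
      ∃ l : ℝ, 0 < l ∧ ∃ q : ℝ, 3 / 2 < q ∧ ∃ m : ℝ → EuclideanSpace ℝ (Fin 3) → ℝ, (∀ t x, 0 ≤ m t x) ∧
        (∀ t ∈ Set.Ico 0 T, ∀ x, l < ‖u t x‖ → ∃ v w : EuclideanSpace ℝ (Fin 3),
          ‖v‖ = 1 ∧ ‖w‖ = 1 ∧ inner ℝ v w = 0 ∧
          ∀ α β : ℝ, inner ℝ (fderiv ℝ (u t) x (α • v + β • w)) (α • v + β • w) ≤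
            m t x * (α ^ 2 + β ^ 2)) ∧
        ∫⁻ t in Set.Ioo 0 T, (∫⁻ x in {x : EuclideanSpace ℝ (Fin 3) | l < ‖u t x‖},
          ENNReal.ofReal (m t x) ^ q) ^ (2 / (2 * q - 3)) < ⊤

/-- **Finite energy is load-bearing** — re-export of the LANDED negative lemma (p150219,
`Theorems/FastClassSqueeze/Negative/FalseWithoutLerayHopf.lean`): the biaxial strain flow from rest
`u = t (x₀, x₁, −2x₂)` is classical from the rapidly decaying datum `0`, global and smooth, yet the
min–max clause forces `m ≥ t` on a fast class of infinite volume. Any proof must use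
`|{|u(t)| > l}| ≤ 2E₀/l²`. [cite: MajdaBertozzi2002, §1.4 (exact solutions with linear velocity field)] -/
theorem fastClassSqueeze_false_without_lerayHopf' : ¬ FastClassSqueezeWithoutLerayHopf :=
  fastClassSqueeze_false_without_lerayHopf

/-- The conclusion of the crux for one field on `[0,T)` (verbatim), named for the statements below. -/
def Conclusion (T : ℝ) (u : ℝ → EuclideanSpace ℝ (Fin 3) → EuclideanSpace ℝ (Fin 3)) : Prop :=
  ∃ l : ℝ, 0 < l ∧ ∃ q : ℝ, 3 / 2 < q ∧ ∃ m : ℝ → EuclideanSpace ℝ (Fin 3) → ℝ, (∀ t x, 0 ≤ m t x) ∧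
    (∀ t ∈ Set.Ico 0 T, ∀ x, l < ‖u t x‖ → ∃ v w : EuclideanSpace ℝ (Fin 3),
      ‖v‖ = 1 ∧ ‖w‖ = 1 ∧ inner ℝ v w = 0 ∧
      ∀ α β : ℝ, inner ℝ (fderiv ℝ (u t) x (α • v + β • w)) (α • v + β • w) ≤
        m t x * (α ^ 2 + β ^ 2)) ∧
    ∫⁻ t in Set.Ioo 0 T, (∫⁻ x in {x : EuclideanSpace ℝ (Fin 3) | l < ‖u t x‖},
      ENNReal.ofReal (m t x) ^ q) ^ (2 / (2 * q - 3)) < ⊤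

/-- The crux, unfolded through `Conclusion` (definitional). [folklore] -/
theorem fastClassSqueeze_iff :
    FastClassSqueeze ↔ ∀ (ν T : ℝ), 0 < ν → 0 < T →
      ∀ (u : ℝ → EuclideanSpace ℝ (Fin 3) → EuclideanSpace ℝ (Fin 3))
        (p : ℝ → EuclideanSpace ℝ (Fin 3) → ℝ),
        IsClassicalNSSolutionOn (Set.Ico 0 T) ν 0 u p → IsLerayHopfOn T ν 0 (u 0) u →
        HasRapidSpatialDecay (u 0) → Conclusion T u :=
  Iff.rfl

/-- For `T ≤ 0` the conclusion is empty-true (`Ico 0 T = Ioo 0 T = ∅`). [folklore] -/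
theorem conclusion_of_nonpos {T : ℝ} (hT : T ≤ 0)
    (u : ℝ → EuclideanSpace ℝ (Fin 3) → EuclideanSpace ℝ (Fin 3)) : Conclusion T u := by
  refine ⟨1, one_pos, 2, by norm_num, fun _ _ => 0, fun _ _ => le_rfl, fun t ht => ?_, ?_⟩
  · exact absurd (ht.1.trans_lt ht.2) (not_lt.2 hT)
  · rw [Set.Ioo_eq_empty (not_lt.2 hT), Measure.restrict_empty, lintegral_zero_measure]
    exact ENNReal.zero_lt_top

/-- The crux with the hypothesis `0 < T` deleted. -/
def FastClassSqueezeWithoutTpos : Prop :=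
  ∀ (ν T : ℝ), 0 < ν →
    ∀ (u : ℝ → EuclideanSpace ℝ (Fin 3) → EuclideanSpace ℝ (Fin 3))
      (p : ℝ → EuclideanSpace ℝ (Fin 3) → ℝ),
      IsClassicalNSSolutionOn (Set.Ico 0 T) ν 0 u p → IsLerayHopfOn T ν 0 (u 0) u →
      HasRapidSpatialDecay (u 0) → Conclusion T u

/-- **`0 < T` is not load-bearing**: deleting it does not change the statement. [folklore] -/
theorem fastClassSqueezeWithoutTpos_iff : FastClassSqueezeWithoutTpos ↔ FastClassSqueeze := by
  rw [fastClassSqueeze_iff]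
  constructor
  · exact fun h ν T hν _ u p hcl hLH hdec => h ν T hν u p hcl hLH hdec
  · intro h ν T hν u p hcl hLH hdec
    rcases lt_or_ge 0 T with hT | hT
    · exact h ν T hν hT u p hcl hLH hdec
    · exact conclusion_of_nonpos hT u

/-! ## §2/§3 Shared algebra: the frame `e₀, e₁`, the middle strain of `c • B`; then the stub kill -/

/-- `e₀ ⊥ e₁`. [folklore] -/
theorem inner_ex_ey : ⟪ex, ey⟫ = 0 := by
  simp [ex, ey, EuclideanSpace.inner_single_left]

/-- The plane spanned by `e₀, e₁` is `{ξ₂ = 0}`. [folklore] -/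
theorem combo_apply_two (α β : ℝ) : (α • ex + β • ey) 2 = 0 := by
  simp [ex, ey]

/-- `‖α e₀ + β e₁‖² = α² + β²`. [folklore] -/
theorem norm_combo_sq (α β : ℝ) : ‖α • ex + β • ey‖ ^ 2 = α ^ 2 + β ^ 2 := by
  have hx : ‖ex‖ = 1 := by simp [ex]
  have hy : ‖ey‖ = 1 := by simp [ey]
  rw [norm_add_sq_real, real_inner_smul_left, real_inner_smul_right, inner_ex_ey, norm_smul,
    norm_smul, hx, hy]
  simp [sq_abs]

/-- **Lower Courant–Fischer bound for the scaled biaxial strain**: the middle principal strain of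
`c • B`, `B = diag(1,1,−2)`, is at least `c` (it equals `c`): on the plane `{ξ₂ = 0}` the form of
`c • B` is `c‖ξ‖²`. [cite: HornJohnson2013, Thm 4.2.6] -/
theorem le_strainEigenvalues_smul_strainB (c : ℝ) :
    c ≤ strainEigenvalues ((c • strainB : (EuclideanSpace ℝ (Fin 3)) →L[ℝ] (EuclideanSpace ℝ (Fin 3))) : (EuclideanSpace ℝ (Fin 3)) →ₗ[ℝ] (EuclideanSpace ℝ (Fin 3)))
      finrank_euclideanSpace_fin 1 := by
  rw [le_strainEigenvalues_mid_iff]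
  refine ⟨ex, ey, by simp [ex], by simp [ey], inner_ex_ey, fun α β => ?_⟩
  show c * (α ^ 2 + β ^ 2) ≤ ⟪c • strainB (α • ex + β • ey), α • ex + β • ey⟫
  rw [real_inner_smul_left, inner_strainB_self (combo_apply_two α β), norm_combo_sq]

/-- The middle principal strain of the zero gradient is `≤ 0` (it is `0`). [folklore] -/
theorem strainEigenvalues_zero_mid_le :
    strainEigenvalues (0 : (EuclideanSpace ℝ (Fin 3)) →ₗ[ℝ] (EuclideanSpace ℝ (Fin 3))) finrank_euclideanSpace_fin 1 ≤ 0 := by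
  rw [strainEigenvalues_mid_le_iff]
  exact ⟨ex, ey, by simp [ex], by simp [ey], inner_ex_ey, fun α β => by simp⟩

/-! ## The witness: rest state for `t ≥ 0`, linear strain junk for `t < 0` -/

/-- The witness field: `u(t) ≡ 0` for `t ≥ 0` (the rest state) and `u(t, x) = (−t)⁻¹ B x` for
`t < 0` — times at which no hypothesis of the stub looks. -/
def junkVel : ℝ → (EuclideanSpace ℝ (Fin 3)) → (EuclideanSpace ℝ (Fin 3)) := fun t x => if t < 0 then (-t)⁻¹ • strainB x else 0

/-- For `t ≥ 0` the witness is the rest state. [folklore] -/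
theorem junkVel_of_nonneg {t : ℝ} (ht : 0 ≤ t) : junkVel t = 0 := by
  funext x
  simp [junkVel, not_lt.2 ht]

/-- For `t < 0` the witness slice is the linear map `(−t)⁻¹ B`. [folklore] -/
theorem junkVel_of_neg {t : ℝ} (ht : t < 0) : junkVel t = ⇑((-t)⁻¹ • strainB) := by
  funext x
  simp [junkVel, ht]

/-- `∇u(t) ≡ (−t)⁻¹ B` for `t < 0`. [folklore] -/
theorem fderiv_junkVel_of_neg {t : ℝ} (ht : t < 0) (x : (EuclideanSpace ℝ (Fin 3))) :
    fderiv ℝ (junkVel t) x = (-t)⁻¹ • strainB := by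
  rw [junkVel_of_neg ht, ContinuousLinearMap.fderiv]

/-- `∇u(t) ≡ 0` for `t ≥ 0`. [folklore] -/
theorem fderiv_junkVel_of_nonneg {t : ℝ} (ht : 0 ≤ t) (x : (EuclideanSpace ℝ (Fin 3))) : fderiv ℝ (junkVel t) x = 0 := by
  rw [junkVel_of_nonneg ht]
  exact fderiv_const_apply 0

/-- Every slice of the witness has a gradient constant in space. [folklore] -/
theorem fderiv_junkVel_const (t : ℝ) (x y : (EuclideanSpace ℝ (Fin 3))) : fderiv ℝ (junkVel t) y = fderiv ℝ (junkVel t) x := by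
  rcases lt_or_ge t 0 with ht | ht
  · rw [fderiv_junkVel_of_neg ht, fderiv_junkVel_of_neg ht]
  · rw [fderiv_junkVel_of_nonneg ht, fderiv_junkVel_of_nonneg ht]

/-- **The subscale gradient of the witness vanishes identically**: a constant gradient equals its
own average over every ball of positive radius. [folklore] -/
theorem fderiv_junkVel_sub_setAverage (t : ℝ) (x : (EuclideanSpace ℝ (Fin 3))) {R : ℝ} (hR : 0 < R) :
    fderiv ℝ (junkVel t) x - ⨍ y in closedBall x R, fderiv ℝ (junkVel t) y = 0 := by
  rw [setAverage_congr_fun measurableSet_closedBall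
      (Eventually.of_forall fun y _ => fderiv_junkVel_const t x y),
    setAverage_const (measure_closedBall_pos volume x hR).ne' measure_closedBall_lt_top.ne, sub_self]

/-- The witness is a classical solution of unforced Navier–Stokes on `[0,1) × ℝ³` (it is the rest
state there; `IsClassicalNSSolutionOn.congr_slices`). [folklore] -/
theorem junkVel_isClassical (ν : ℝ) : IsClassicalNSSolutionOn (Ico 0 1) ν 0 junkVel 0 :=
  (isClassicalNSSolutionOn_zero (Ico (0 : ℝ) 1) ν).congr_slices
    (fun _ ht => junkVel_of_nonneg ht.1) (fun _ _ => rfl)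

/-- The witness is Leray–Hopf on `[0,1]` from its datum `u 0 = 0` (it is the rest state there;
`IsLerayHopfOn.congr_ae_slices`). [folklore] -/
theorem junkVel_isLerayHopf (ν : ℝ) : IsLerayHopfOn 1 ν 0 (junkVel 0) junkVel := by
  rw [junkVel_of_nonneg le_rfl]
  refine (isLerayHopfOn_zero (E := (EuclideanSpace ℝ (Fin 3))) 1 ν).congr_ae_slices one_pos ?_ fun t ht => ?_
  · refine (aestronglyMeasurable_const (b := (0 : (EuclideanSpace ℝ (Fin 3))))).congr ?_
    filter_upwards [ae_restrict_mem (measurableSet_Ioo.prod MeasurableSet.univ)] with z hz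
    show (0 : (EuclideanSpace ℝ (Fin 3))) = junkVel z.1 z.2
    rw [junkVel_of_nonneg (le_of_lt hz.1.1)]
    rfl
  · rw [junkVel_of_nonneg ht.1]
    exact EventuallyEq.rfl

/-! ## The fast ball and the lower bound on the full middle strain -/

/-- The centre `3 e₀` of the fast ball. -/
def fastCentre : (EuclideanSpace ℝ (Fin 3)) := (3 : ℝ) • ex

/-- Points of `B(3e₀, 1)` have norm `> 2`. [folklore] -/
theorem two_lt_norm_of_mem_ball {x : (EuclideanSpace ℝ (Fin 3))} (hx : x ∈ ball fastCentre 1) : 2 < ‖x‖ := by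
  have h1 : ‖fastCentre‖ = 3 := by
    rw [fastCentre, norm_smul, Real.norm_eq_abs]
    simp [ex]
  have h2 : ‖x - fastCentre‖ < 1 := by rwa [mem_ball, dist_eq_norm] at hx
  have h3 : ‖fastCentre‖ ≤ ‖x‖ + ‖x - fastCentre‖ := by
    calc ‖fastCentre‖ = ‖x - (x - fastCentre)‖ := by rw [sub_sub_cancel]
      _ ≤ ‖x‖ + ‖x - fastCentre‖ := norm_sub_le _ _
  linarith

/-- For `t ∈ (−1, 0)` the whole ball `B(3e₀, 1)` is fast at level `1`: `|u(t,x)| ≥ (−t)⁻¹‖x‖ > 2`.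
[folklore] -/
theorem ball_subset_fast {t : ℝ} (ht : t ∈ Ioo (-1 : ℝ) 0) :
    ball fastCentre 1 ⊆ {x : (EuclideanSpace ℝ (Fin 3)) | 1 < ‖junkVel t x‖} := by
  intro x hx
  have hlam : 1 < (-t)⁻¹ := (one_lt_inv₀ (neg_pos.2 ht.2)).2 (by linarith [ht.1])
  show 1 < ‖junkVel t x‖
  rw [junkVel_of_neg ht.2]
  show 1 < ‖(-t)⁻¹ • strainB x‖
  rw [norm_smul, Real.norm_eq_abs, abs_of_pos (inv_pos.2 (neg_pos.2 ht.2))]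
  calc (1 : ℝ) < 2 := one_lt_two
    _ < ‖x‖ := two_lt_norm_of_mem_ball hx
    _ ≤ ‖strainB x‖ := norm_le_norm_strainB x
    _ = 1 * ‖strainB x‖ := (one_mul _).symm
    _ ≤ (-t)⁻¹ * ‖strainB x‖ := mul_le_mul_of_nonneg_right hlam.le (norm_nonneg _)

/-- **Lower bound on the conclusion's inner integral** for `t ∈ (−1, 0)`:
`(ofReal (−t)⁻¹)³ · |B(3e₀,1)| ≤ ∫_{fast ∩ B(3e₀,1)} (λ₁⁺(∇u(t)))³`. [folklore] -/
theorem inner_lower_bound {t : ℝ} (ht : t ∈ Ioo (-1 : ℝ) 0) :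
    ENNReal.ofReal ((-t)⁻¹) ^ (3 : ℝ) * volume (ball fastCentre 1) ≤
      ∫⁻ x in {x : (EuclideanSpace ℝ (Fin 3)) | 1 < ‖junkVel t x‖} ∩ ball fastCentre 1,
        ENNReal.ofReal (strainEigenvalues ((fderiv ℝ (junkVel t) x : (EuclideanSpace ℝ (Fin 3)) →L[ℝ] (EuclideanSpace ℝ (Fin 3))) : (EuclideanSpace ℝ (Fin 3)) →ₗ[ℝ] (EuclideanSpace ℝ (Fin 3)))
          finrank_euclideanSpace_fin 1) ^ (3 : ℝ) := by
  rw [inter_eq_right.2 (ball_subset_fast ht), ← setLIntegral_const]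
  refine setLIntegral_mono' measurableSet_ball fun x _ => ?_
  rw [fderiv_junkVel_of_neg ht.2]
  exact ENNReal.rpow_le_rpow (ENNReal.ofReal_le_ofReal (le_strainEigenvalues_smul_strainB _))
    (by norm_num)

/-! ## §3 Targets: `stub_pointSqueeze_of_subscale` is false as registered (mirror of p161450) -/

/-- **`stub_pointSqueeze_of_subscale` is false as registered** (negative-time junk; misstated —
repair: `0 ≤ τ`). Witness `ν = T = 1`, `u = junkVel` (rest state on `t ≥ 0`, `(−t)⁻¹ B x` on
`t < 0`), `p = 0`, `x₀ = 3e₀`, `r = R = 1`, `τ = −1`, `l = 1`, `q = 3`: the subscale functional is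
`0`, the full one is `∞` (integrand `≥ c (−t)⁻²` on `(−1, 0)`).
[cite: MajdaBertozzi2002, §1.4 (exact solutions with linear velocity field)] -/
theorem stub_pointSqueeze_of_subscale_false :
    ¬ (∀ (ν T : ℝ), 0 < ν → 0 < T → ∀ (u : ℝ → EuclideanSpace ℝ (Fin 3) → EuclideanSpace ℝ (Fin 3)) (p : ℝ → EuclideanSpace ℝ (Fin 3) → ℝ), Literature.Analysis.FluidPDE.IsClassicalNSSolutionOn (Set.Ico 0 T) ν 0 u p → Literature.Analysis.FluidPDE.IsLerayHopfOn T ν 0 (u 0) u → ∀ (x₀ : EuclideanSpace ℝ (Fin 3)) (r R τ l q : ℝ), 0 < l → 3 ≤ q → ∫⁻ t in Set.Ioo τ T, (∫⁻ x in {x : EuclideanSpace ℝ (Fin 3) | l < ‖u t x‖} ∩ Metric.ball x₀ r, ENNReal.ofReal (Literature.Analysis.FluidPDE.strainEigenvalues ((fderiv ℝ (u t) x - ⨍ y in Metric.closedBall x R, fderiv ℝ (u t) y : EuclideanSpace ℝ (Fin 3) →L[ℝ] EuclideanSpace ℝ (Fin 3)) : EuclideanSpace ℝ (Fin 3) →ₗ[ℝ]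 EuclideanSpace ℝ (Fin 3)) finrank_euclideanSpace_fin 1) ^ q) ^ (2 / (2 * q - 3)) < ⊤ → ∫⁻ t in Set.Ioo τ T, (∫⁻ x in {x : EuclideanSpace ℝ (Fin 3) | l < ‖u t x‖} ∩ Metric.ball x₀ r, ENNReal.ofReal (Literature.Analysis.FluidPDE.strainEigenvalues ((fderiv ℝ (u t) x : EuclideanSpace ℝ (Fin 3) →L[ℝ] EuclideanSpace ℝ (Fin 3)) : EuclideanSpace ℝ (Fin 3) →ₗ[ℝ] EuclideanSpace ℝ (Fin 3)) finrank_euclideanSpace_fin 1) ^ q) ^ (2 / (2 * q - 3)) < ⊤) := by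
  intro h
  have hexp : (0 : ℝ) < 2 / (2 * 3 - 3) := by norm_num
  -- the hypothesis functional of the witness vanishes identically (subscale gradient ≡ 0)
  have hzero : ∀ (t : ℝ) (x : (EuclideanSpace ℝ (Fin 3))), ENNReal.ofReal (strainEigenvalues
      ((fderiv ℝ (junkVel t) x - ⨍ y in closedBall x (1 : ℝ), fderiv ℝ (junkVel t) y :
        (EuclideanSpace ℝ (Fin 3)) →L[ℝ] (EuclideanSpace ℝ (Fin 3))) : (EuclideanSpace ℝ (Fin 3)) →ₗ[ℝ] (EuclideanSpace ℝ (Fin 3))) finrank_euclideanSpace_fin 1) ^ (3 : ℝ) = 0 := by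
    intro t x
    rw [fderiv_junkVel_sub_setAverage t x one_pos, ContinuousLinearMap.toLinearMap_zero,
      ENNReal.ofReal_of_nonpos strainEigenvalues_zero_mid_le, ENNReal.zero_rpow_of_pos (by norm_num)]
  have hhyp : ∫⁻ t in Set.Ioo (-1 : ℝ) 1, (∫⁻ x in {x : (EuclideanSpace ℝ (Fin 3)) | 1 < ‖junkVel t x‖} ∩ ball fastCentre 1,
      ENNReal.ofReal (strainEigenvalues
        ((fderiv ℝ (junkVel t) x - ⨍ y in closedBall x (1 : ℝ), fderiv ℝ (junkVel t) y :
          (EuclideanSpace ℝ (Fin 3)) →L[ℝ] (EuclideanSpace ℝ (Fin 3))) : (EuclideanSpace ℝ (Fin 3)) →ₗ[ℝ] (EuclideanSpace ℝ (Fin 3))) finrank_euclideanSpace_fin 1) ^ (3 : ℝ)) ^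
        (2 / (2 * 3 - 3) : ℝ) < ⊤ := by
    simp only [hzero, lintegral_const, zero_mul, ENNReal.zero_rpow_of_pos hexp]
    exact ENNReal.zero_lt_top
  have key := h 1 1 one_pos one_pos junkVel 0 (junkVel_isClassical 1) (junkVel_isLerayHopf 1)
    fastCentre 1 1 (-1) 1 3 one_pos le_rfl hhyp
  -- the conclusion functional of the witness is infinite
  revert key
  rw [imp_false, not_lt, top_le_iff]
  apply ENNReal.eq_top_of_forall_nnreal_le
  intro c
  -- constants: the fast ball's volume and the integrand's lower bound
  have hV0 : volume (ball fastCentre 1) ≠ 0 := (measure_ball_pos volume fastCentre one_pos).ne'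
  have hVtop : volume (ball fastCentre 1) ≠ ⊤ := measure_ball_lt_top.ne
  set V' : ℝ≥0∞ := volume (ball fastCentre 1) ^ (2 / 3 : ℝ) with hV'
  have hV'0 : V' ≠ 0 := (ENNReal.rpow_pos (pos_iff_ne_zero.2 hV0) hVtop).ne'
  have hV'top : V' ≠ ⊤ := ENNReal.rpow_ne_top_of_nonneg (by norm_num) hVtop
  have hvpos : 0 < V'.toReal := ENNReal.toReal_pos hV'0 hV'top
  -- the time window `(−ε, 0)`
  set ε : ℝ := min 1 (V'.toReal / ((c : ℝ) + 1)) with hε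
  have hε0 : 0 < ε := lt_min one_pos (div_pos hvpos (by positivity))
  have hε1 : ε ≤ 1 := min_le_left _ _
  have hεv : ε ≤ V'.toReal / ((c : ℝ) + 1) := min_le_right _ _
  -- pointwise lower bound of the conclusion's integrand on the window
  have hG : ∀ t ∈ Ioo (-ε) (0 : ℝ), ENNReal.ofReal (ε⁻¹) ^ (2 : ℝ) * V' ≤
      (∫⁻ x in {x : (EuclideanSpace ℝ (Fin 3)) | 1 < ‖junkVel t x‖} ∩ ball fastCentre 1,
        ENNReal.ofReal (strainEigenvalues ((fderiv ℝ (junkVel t) x : (EuclideanSpace ℝ (Fin 3)) →L[ℝ] (EuclideanSpace ℝ (Fin 3))) : (EuclideanSpace ℝ (Fin 3)) →ₗ[ℝ] (EuclideanSpace ℝ (Fin 3)))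
          finrank_euclideanSpace_fin 1) ^ (3 : ℝ)) ^ (2 / (2 * 3 - 3) : ℝ) := by
    intro t ht
    have ht' : t ∈ Ioo (-1 : ℝ) 0 := ⟨by linarith [ht.1], ht.2⟩
    have hte : ENNReal.ofReal (ε⁻¹) ≤ ENNReal.ofReal ((-t)⁻¹) :=
      ENNReal.ofReal_le_ofReal (inv_anti₀ (neg_pos.2 ht.2) (by linarith [ht.1]))
    have h23 : (2 / (2 * 3 - 3) : ℝ) = 2 / 3 := by norm_num
    calc ENNReal.ofReal (ε⁻¹) ^ (2 : ℝ) * V'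
        = (ENNReal.ofReal (ε⁻¹) ^ (3 : ℝ) * volume (ball fastCentre 1)) ^ (2 / 3 : ℝ) := by
          rw [hV', ENNReal.mul_rpow_of_nonneg _ _ (by norm_num : (0 : ℝ) ≤ 2 / 3),
            ← ENNReal.rpow_mul]
          norm_num
      _ ≤ (ENNReal.ofReal ((-t)⁻¹) ^ (3 : ℝ) * volume (ball fastCentre 1)) ^ (2 / 3 : ℝ) := by
          gcongr
      _ ≤ _ := by
          rw [h23]
          exact ENNReal.rpow_le_rpow (inner_lower_bound ht') (by norm_num)
  -- integrate the lower bound over the window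
  calc (c : ℝ≥0∞) ≤ ENNReal.ofReal (ε⁻¹ * V'.toReal) := by
        rw [← ENNReal.ofReal_coe_nnreal]
        refine ENNReal.ofReal_le_ofReal ?_
        rw [le_inv_mul_iff₀ hε0]
        rw [le_div_iff₀ (by positivity)] at hεv
        nlinarith [hε0, hεv]
    _ = ENNReal.ofReal (ε⁻¹) ^ (2 : ℝ) * V' * volume (Ioo (-ε) (0 : ℝ)) := by
        have hreal : ε⁻¹ * V'.toReal = ε⁻¹ ^ (2 : ℕ) * V'.toReal * ε := by
          field_simp
        rw [hreal, ENNReal.ofReal_mul (by positivity), ENNReal.ofReal_mul (by positivity),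
          ENNReal.ofReal_toReal hV'top, Real.volume_Ioo, sub_neg_eq_add, zero_add,
          ← Real.rpow_natCast, ENNReal.ofReal_rpow_of_nonneg (by positivity) (by norm_num)]
        norm_num
    _ = ∫⁻ _ in Ioo (-ε) (0 : ℝ), ENNReal.ofReal (ε⁻¹) ^ (2 : ℝ) * V' :=
        (setLIntegral_const _ _).symm
    _ ≤ ∫⁻ t in Ioo (-ε) (0 : ℝ), (∫⁻ x in {x : (EuclideanSpace ℝ (Fin 3)) | 1 < ‖junkVel t x‖} ∩ ball fastCentre 1,
          ENNReal.ofReal (strainEigenvalues ((fderiv ℝ (junkVel t) x : (EuclideanSpace ℝ (Fin 3)) →L[ℝ] (EuclideanSpace ℝ (Fin 3))) : (EuclideanSpace ℝ (Fin 3)) →ₗ[ℝ] (EuclideanSpace ℝ (Fin 3)))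
            finrank_euclideanSpace_fin 1) ^ (3 : ℝ)) ^ (2 / (2 * 3 - 3) : ℝ) :=
        setLIntegral_mono' measurableSet_Ioo hG
    _ ≤ _ := lintegral_mono_set (Ioo_subset_Ioo (by linarith) zero_le_one)


/-! ## §2 Tightness of the exponent side condition -/

/-- **The strict inequality `3/2 < q` is exactly tight against junk**: with `3/2 ≤ q` allowed, the
conclusion holds for EVERY field `u` on every `[0,T)` — take `q = 3/2`, `l = 1` and the operator norm
`m = ‖∇u‖` (a min–max majorant on the frame `e₀, e₁` by Cauchy–Schwarz); then the exponent
`2/(2q−3) = 2/0 = 0` in Lean, the time integrand is `1` and the functional is `T < ∞`. So no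
restatement may relax the exponent range, and no proof may pass through the `q = 3/2` endpoint
formally. [folklore] -/
theorem conclusion_junk_at_endpoint (T : ℝ)
    (u : ℝ → EuclideanSpace ℝ (Fin 3) → EuclideanSpace ℝ (Fin 3)) :
    ∃ l : ℝ, 0 < l ∧ ∃ q : ℝ, 3 / 2 ≤ q ∧ ∃ m : ℝ → EuclideanSpace ℝ (Fin 3) → ℝ, (∀ t x, 0 ≤ m t x) ∧
      (∀ t ∈ Set.Ico 0 T, ∀ x, l < ‖u t x‖ → ∃ v w : EuclideanSpace ℝ (Fin 3),
        ‖v‖ = 1 ∧ ‖w‖ = 1 ∧ inner ℝ v w = 0 ∧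
        ∀ α β : ℝ, inner ℝ (fderiv ℝ (u t) x (α • v + β • w)) (α • v + β • w) ≤
          m t x * (α ^ 2 + β ^ 2)) ∧
      ∫⁻ t in Set.Ioo 0 T, (∫⁻ x in {x : EuclideanSpace ℝ (Fin 3) | l < ‖u t x‖},
        ENNReal.ofReal (m t x) ^ q) ^ (2 / (2 * q - 3)) < ⊤ := by
  refine ⟨1, one_pos, 3 / 2, le_rfl, fun t x => ‖fderiv ℝ (u t) x‖, fun _ _ => norm_nonneg _,
    fun t _ x _ => ⟨ex, ey, by simp [ex], by simp [ey], inner_ex_ey, fun α β => ?_⟩, ?_⟩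
  · calc inner ℝ (fderiv ℝ (u t) x (α • ex + β • ey)) (α • ex + β • ey)
        ≤ ‖fderiv ℝ (u t) x (α • ex + β • ey)‖ * ‖α • ex + β • ey‖ := real_inner_le_norm _ _
      _ ≤ ‖fderiv ℝ (u t) x‖ * ‖α • ex + β • ey‖ * ‖α • ex + β • ey‖ := by
          gcongr
          exact ContinuousLinearMap.le_opNorm _ _
      _ = ‖fderiv ℝ (u t) x‖ * (α ^ 2 + β ^ 2) := by
          rw [mul_assoc, ← sq, norm_combo_sq]
  · have h0 : (2 : ℝ) / (2 * (3 / 2) - 3) = 0 := by norm_num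
    simp only [h0, ENNReal.rpow_zero, setLIntegral_one, Real.volume_Ioo]
    exact ENNReal.ofReal_lt_top

/-! ## §5 The conclusion of `FastClassSqueeze` is not kinematic (closed; mirror of Negative/KinematicBlob + FalseKinematic) -/

/-- `FastClassSqueeze`'s conclusion demanded of every jointly smooth, divergence-free, compactly
supported-in-space field on `[0,T) × ℝ³` with finite, NON-INCREASING energy, FINITE total
dissipation, the TYPE-I (self-similar) rate and a bounded critical norm `sup_t ∫|u(t)|³` (the ESS class
`L^∞_t L³_x`) — i.e. of every field carrying all the a-priori information a Leray–Hopf classical flow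
is known to carry, but not the equation. -/
def FastClassSqueezeKinematic : Prop :=
  ∀ (T : ℝ), 0 < T → ∀ (u : ℝ → EuclideanSpace ℝ (Fin 3) → EuclideanSpace ℝ (Fin 3)),
    IsSmoothSpaceTimeOn (Set.Ico 0 T) u →
    (∀ t ∈ Set.Ico 0 T, VectorCalculus.IsDivFree (u t)) →
    (∀ t ∈ Set.Ico 0 T, HasCompactSupport (u t)) →
    (∀ t ∈ Set.Ico 0 T, ∫⁻ x, ‖u t x‖ₑ ^ 2 < ⊤) →
    (∀ s ∈ Set.Ico 0 T, ∀ t ∈ Set.Ico 0 T, s ≤ t → ∫⁻ x, ‖u t x‖ₑ ^ 2 ≤ ∫⁻ x, ‖u s x‖ₑ ^ 2) →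
    (∫⁻ t in Set.Ioo 0 T, ∫⁻ x, ‖fderiv ℝ (u t) x‖ₑ ^ 2 < ⊤) →
    (∃ M : ℝ, ∀ t ∈ Set.Ico 0 T, ∀ x, ‖u t x‖ ≤ M / Real.sqrt (T - t)) →
    (∃ C : ℝ≥0∞, C < ⊤ ∧ ∀ t ∈ Set.Ico 0 T, ∫⁻ x, ‖u t x‖ₑ ^ 3 ≤ C) →
    Conclusion T u

/-! ### §5 · The profile `U = curl (χ A)`: smooth, compactly supported, divergence free, `= B` on the unit ball -/

/-- The quadratic vector potential `A(x) = (x₁x₂, −x₀x₂, 0)`, with `curl A = (x₀, x₁, −2x₂) = B x`. -/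
def quadPot : EuclideanSpace ℝ (Fin 3) → EuclideanSpace ℝ (Fin 3) :=
  fun x => (x 1 * x 2) • ex + (-(x 0 * x 2)) • ey

/-- A smooth cut-off: `1` on the closed unit ball, supported in the ball of radius `2`. -/
def cutoff : ContDiffBump (0 : EuclideanSpace ℝ (Fin 3)) := ⟨1, 2, one_pos, one_lt_two⟩

/-- The cut-off potential `χ A`. -/
def cutPot : EuclideanSpace ℝ (Fin 3) → EuclideanSpace ℝ (Fin 3) := fun x => cutoff x • quadPot x

/-- **The biaxProfile** `U = curl (χ A)`. -/
def biaxProfile : EuclideanSpace ℝ (Fin 3) → EuclideanSpace ℝ (Fin 3) := curl cutPot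

/-- The derivative of the quadratic potential. [folklore] -/
theorem hasFDerivAt_quadPot (x : EuclideanSpace ℝ (Fin 3)) :
    HasFDerivAt quadPot
      ((x 1 • (EuclideanSpace.proj 2 : EuclideanSpace ℝ (Fin 3) →L[ℝ] ℝ) +
          x 2 • (EuclideanSpace.proj 1 : EuclideanSpace ℝ (Fin 3) →L[ℝ] ℝ)).smulRight ex +
        (-(x 0 • (EuclideanSpace.proj 2 : EuclideanSpace ℝ (Fin 3) →L[ℝ] ℝ) +
          x 2 • (EuclideanSpace.proj 0 : EuclideanSpace ℝ (Fin 3) →L[ℝ] ℝ))).smulRight ey) x := by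
  have h0 : HasFDerivAt (fun y : EuclideanSpace ℝ (Fin 3) => y 0)
      (EuclideanSpace.proj 0 : EuclideanSpace ℝ (Fin 3) →L[ℝ] ℝ) x := PiLp.hasFDerivAt_apply 2 x 0
  have h1 : HasFDerivAt (fun y : EuclideanSpace ℝ (Fin 3) => y 1)
      (EuclideanSpace.proj 1 : EuclideanSpace ℝ (Fin 3) →L[ℝ] ℝ) x := PiLp.hasFDerivAt_apply 2 x 1
  have h2 : HasFDerivAt (fun y : EuclideanSpace ℝ (Fin 3) => y 2)
      (EuclideanSpace.proj 2 : EuclideanSpace ℝ (Fin 3) →L[ℝ] ℝ) x := PiLp.hasFDerivAt_apply 2 x 2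
  exact ((h1.mul h2).smul_const ex).add (((h0.mul h2).neg).smul_const ey)

/-- The quadratic potential is smooth. [folklore] -/
theorem contDiff_quadPot {n : WithTop ℕ∞} : ContDiff ℝ n quadPot := by
  have h0 : ContDiff ℝ n (fun y : EuclideanSpace ℝ (Fin 3) => y 0) :=
    contDiff_piLp_apply (p := 2) (i := (0 : Fin 3))
  have h1 : ContDiff ℝ n (fun y : EuclideanSpace ℝ (Fin 3) => y 1) :=
    contDiff_piLp_apply (p := 2) (i := (1 : Fin 3))
  have h2 : ContDiff ℝ n (fun y : EuclideanSpace ℝ (Fin 3) => y 2) :=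
    contDiff_piLp_apply (p := 2) (i := (2 : Fin 3))
  exact ((h1.mul h2).smul contDiff_const).add ((h0.mul h2).neg.smul contDiff_const)

/-- The cut-off potential is smooth. [folklore] -/
theorem contDiff_cutPot {n : ℕ∞} : ContDiff ℝ n cutPot := by
  show ContDiff ℝ n fun x => cutoff x • quadPot x
  exact cutoff.contDiff.smul contDiff_quadPot

/-- The cut-off potential has compact support. [folklore] -/
theorem hasCompactSupport_cutPot : HasCompactSupport cutPot :=
  cutoff.hasCompactSupport.smul_right

/-- The biaxProfile is smooth. [folklore] -/
theorem contDiff_biaxProfile {n : ℕ∞} : ContDiff ℝ n biaxProfile :=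
  contDiff_curl (by exact_mod_cast contDiff_cutPot (n := n + 1))

/-- The biaxProfile has compact support. [folklore] -/
theorem hasCompactSupport_biaxProfile : HasCompactSupport biaxProfile :=
  hasCompactSupport_curl hasCompactSupport_cutPot

/-- The biaxProfile is divergence free (`div curl = 0`). [folklore] -/
theorem divergence_biaxProfile (x : EuclideanSpace ℝ (Fin 3)) : VectorCalculus.divergence biaxProfile x = 0 :=
  divergence_curl_eq_zero_holds cutPot (by exact_mod_cast contDiff_cutPot (n := 2)) x

/-- `curl A = B` pointwise. [folklore] -/
theorem curl_quadPot (x : EuclideanSpace ℝ (Fin 3)) : curl quadPot x = strainB x := by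
  have hfd := (hasFDerivAt_quadPot x).fderiv
  ext i
  fin_cases i
  · simp [curl, hfd, ex, ey, ez, strainB_apply, Fin.ext_iff]
  · simp [curl, hfd, ex, ey, ez, strainB_apply, Fin.ext_iff]
  · simp [curl, hfd, ex, ey, ez, strainB_apply, Fin.ext_iff]
    ring

/-- On the open unit ball the cut-off potential IS the quadratic potential, so their Jacobians agree
there. [folklore] -/
theorem fderiv_cutPot_of_mem_ball {x : EuclideanSpace ℝ (Fin 3)} (hx : x ∈ ball (0 : EuclideanSpace ℝ (Fin 3)) 1) :
    fderiv ℝ cutPot x = fderiv ℝ quadPot x := by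
  refine Filter.EventuallyEq.fderiv_eq ?_
  filter_upwards [isOpen_ball.mem_nhds hx] with y hy
  show cutoff y • quadPot y = quadPot y
  rw [cutoff.one_of_mem_closedBall (ball_subset_closedBall hy), one_smul]

/-- **The biaxProfile is the biaxial strain on the unit ball**: `U = B` on `ball 0 1`. [folklore] -/
theorem biaxProfile_of_mem_ball {x : EuclideanSpace ℝ (Fin 3)} (hx : x ∈ ball (0 : EuclideanSpace ℝ (Fin 3)) 1) :
    biaxProfile x = strainB x := by
  rw [← curl_quadPot x]
  show curlCLM (fderiv ℝ cutPot x) = curlCLM (fderiv ℝ quadPot x)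
  rw [fderiv_cutPot_of_mem_ball hx]

/-- The biaxProfile is `C¹`-differentiable everywhere. [folklore] -/
theorem differentiable_biaxProfile : Differentiable ℝ biaxProfile :=
  (contDiff_biaxProfile (n := 1)).differentiable (by simp)

/-- The biaxProfile is bounded (continuous with compact support). [folklore] -/
theorem exists_bound_biaxProfile : ∃ C : ℝ, ∀ x, ‖biaxProfile x‖ ≤ C :=
  hasCompactSupport_biaxProfile.exists_bound_of_continuous (contDiff_biaxProfile (n := 0)).continuous

/-- The biaxProfile has finite energy `∫ ‖U‖² < ∞`. [folklore] -/
theorem lintegral_biaxProfile_sq_lt_top :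
    ∫⁻ x, ‖biaxProfile x‖ₑ ^ 2 < ⊤ := by
  have h : MemLp biaxProfile 2 (volume : Measure (EuclideanSpace ℝ (Fin 3))) :=
    (contDiff_biaxProfile (n := 0)).continuous.memLp_of_hasCompactSupport hasCompactSupport_biaxProfile
  have := lintegral_rpow_enorm_lt_top_of_eLpNorm_lt_top two_ne_zero ENNReal.ofNat_ne_top h.eLpNorm_lt_top
  simpa [ENNReal.toReal_ofNat] using this

/-- The biaxProfile has finite enstrophy-type integral `∫ ‖∇U‖² < ∞`. [folklore] -/
theorem lintegral_fderiv_biaxProfile_sq_lt_top :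
    ∫⁻ x, ‖fderiv ℝ biaxProfile x‖ₑ ^ 2 < ⊤ := by
  have hc : Continuous (fderiv ℝ biaxProfile) := (contDiff_biaxProfile (n := 1)).continuous_fderiv (by simp)
  have h : MemLp (fderiv ℝ biaxProfile) 2 (volume : Measure (EuclideanSpace ℝ (Fin 3))) :=
    hc.memLp_of_hasCompactSupport (hasCompactSupport_biaxProfile.fderiv (𝕜 := ℝ))
  have := lintegral_rpow_enorm_lt_top_of_eLpNorm_lt_top two_ne_zero ENNReal.ofNat_ne_top h.eLpNorm_lt_top
  simpa [ENNReal.toReal_ofNat] using this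

/-! ### §5 · The self-similar-rate collapse `u(t, x) = λ U(λ x)`, `λ = (1 − t)^{-1/2}` -/

/-- The collapse rate `λ(t) = 1/√(1 − t)` (the self-similar, Type-I rate towards `T = 1`). -/
def rate (t : ℝ) : ℝ := (Real.sqrt (1 - t))⁻¹

/-- `λ(t) > 0` for `t < 1`. [folklore] -/
theorem rate_pos {t : ℝ} (ht : t < 1) : 0 < rate t :=
  inv_pos.2 (Real.sqrt_pos.2 (by linarith))

/-- `λ(t)⁻¹ = √(1 − t)`. [folklore] -/
theorem rate_inv (t : ℝ) : (rate t)⁻¹ = Real.sqrt (1 - t) := inv_inv _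

/-- `λ(t)² = (1 − t)⁻¹` for `t < 1`. [folklore] -/
theorem rate_sq {t : ℝ} (ht : t < 1) : rate t ^ 2 = (1 - t)⁻¹ := by
  rw [rate, inv_pow, Real.sq_sqrt (by linarith)]

/-- `λ` is smooth on `t < 1`. [folklore] -/
theorem contDiffAt_rate {t : ℝ} (ht : t < 1) {n : WithTop ℕ∞} : ContDiffAt ℝ n rate t := by
  have h1 : ContDiffAt ℝ n (fun s : ℝ => 1 - s) t := contDiffAt_const.sub contDiffAt_id
  have h2 : ContDiffAt ℝ n (fun s : ℝ => Real.sqrt (1 - s)) t := h1.sqrt (by linarith)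
  exact h2.inv (Real.sqrt_ne_zero'.2 (by linarith))

/-- A dilated, amplified copy of the biaxProfile: `x ↦ c U(c x)`. -/
def blobSlice (c : ℝ) : EuclideanSpace ℝ (Fin 3) → EuclideanSpace ℝ (Fin 3) :=
  fun x => c • biaxProfile (c • x)

/-- **The witness**: the self-similar-rate collapsing blob `u(t, x) = λ(t) U(λ(t) x)`. -/
def blob : ℝ → EuclideanSpace ℝ (Fin 3) → EuclideanSpace ℝ (Fin 3) := fun t => blobSlice (rate t)

/-- `∇(c U(c ·))(x) = c² ∇U(c x)`. [folklore] -/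
theorem fderiv_blobSlice (c : ℝ) (x : EuclideanSpace ℝ (Fin 3)) :
    fderiv ℝ (blobSlice c) x = (c * c) • fderiv ℝ biaxProfile (c • x) := by
  have h1 : HasFDerivAt (fun y : EuclideanSpace ℝ (Fin 3) => c • y)
      (c • ContinuousLinearMap.id ℝ (EuclideanSpace ℝ (Fin 3))) x := (hasFDerivAt_id x).const_smul c
  have h2 : HasFDerivAt biaxProfile (fderiv ℝ biaxProfile (c • x)) (c • x) :=
    (differentiable_biaxProfile _).hasFDerivAt
  have h3 := (h2.comp x h1).const_smul c
  rw [show blobSlice c = c • (biaxProfile ∘ fun y : EuclideanSpace ℝ (Fin 3) => c • y) from rfl, h3.fderiv]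
  ext y i
  simp [mul_smul]

/-- `∇u(t) = λ² ∇U(λ ·)`. [folklore] -/
theorem fderiv_blob (t : ℝ) (x : EuclideanSpace ℝ (Fin 3)) :
    fderiv ℝ (blob t) x = (rate t * rate t) • fderiv ℝ biaxProfile (rate t • x) :=
  fderiv_blobSlice (rate t) x

/-- The witness is jointly smooth on `[0,1) × ℝ³`. [folklore] -/
theorem blob_isSmoothSpaceTimeOn : IsSmoothSpaceTimeOn (Ico 0 1) blob := by
  intro z hz
  have hz1 : z.1 < 1 := (mem_prod.1 hz).1.2
  have hr : ContDiffAt ℝ ∞ (fun w : ℝ × EuclideanSpace ℝ (Fin 3) => rate w.1) z :=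
    (contDiffAt_rate hz1).comp z contDiffAt_fst
  have hin : ContDiffAt ℝ ∞ (fun w : ℝ × EuclideanSpace ℝ (Fin 3) => rate w.1 • w.2) z :=
    hr.smul contDiffAt_snd
  have hU : ContDiffAt ℝ ∞ (fun w : ℝ × EuclideanSpace ℝ (Fin 3) => biaxProfile (rate w.1 • w.2)) z :=
    (contDiff_biaxProfile (n := ⊤)).contDiffAt.comp z hin
  exact (hr.smul hU).contDiffWithinAt

/-- The witness is divergence free at every time. [folklore] -/
theorem blob_isDivFree (t : ℝ) : VectorCalculus.IsDivFree (blob t) := by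
  intro x
  have h := divergence_biaxProfile (rate t • x)
  unfold VectorCalculus.divergence at h ⊢
  rw [fderiv_blob, ContinuousLinearMap.toLinearMap_smul, map_smul, h, smul_zero]

/-- Every slice of the witness before the collapse time has compact support. [folklore] -/
theorem blob_hasCompactSupport {t : ℝ} (ht : t < 1) : HasCompactSupport (blob t) := by
  have h1 : HasCompactSupport (fun y : EuclideanSpace ℝ (Fin 3) => biaxProfile (rate t • y)) :=
    hasCompactSupport_biaxProfile.comp_homeomorph (Homeomorph.smulOfNeZero (rate t) (rate_pos ht).ne')
  exact h1.smul_left (f := fun _ => rate t)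

/-- **Energy of the slices**: `∫ |c U(c x)|² dx = c⁻¹ ∫ |U|²` (`c > 0`). [folklore] -/
theorem lintegral_blobSlice_sq {c : ℝ} (hc : 0 < c) :
    ∫⁻ x, ‖blobSlice c x‖ₑ ^ 2 = ENNReal.ofReal c⁻¹ * ∫⁻ x, ‖biaxProfile x‖ₑ ^ 2 := by
  have h1 : ∀ x, ‖blobSlice c x‖ₑ ^ 2 = ENNReal.ofReal (c ^ 2) * ‖biaxProfile (c • x)‖ₑ ^ 2 := by
    intro x
    rw [blobSlice, enorm_smul, mul_pow, Real.enorm_eq_ofReal hc.le, ENNReal.ofReal_pow hc.le]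
  simp_rw [h1]
  rw [lintegral_const_mul' _ _ ENNReal.ofReal_ne_top,
    HomSobolevSymmetry.lintegral_comp_smul (fun x => ‖biaxProfile x‖ₑ ^ 2) hc, ← mul_assoc, ← ENNReal.ofReal_mul (by positivity)]
  congr 2
  field_simp

/-- **Dissipation of the slices**: `∫ |∇(c U(c ·))|² = c ∫ |∇U|²` (`c > 0`). [folklore] -/
theorem lintegral_fderiv_blobSlice_sq {c : ℝ} (hc : 0 < c) :
    ∫⁻ x, ‖fderiv ℝ (blobSlice c) x‖ₑ ^ 2 = ENNReal.ofReal c * ∫⁻ x, ‖fderiv ℝ biaxProfile x‖ₑ ^ 2 := by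
  have h1 : ∀ x, ‖fderiv ℝ (blobSlice c) x‖ₑ ^ 2 =
      ENNReal.ofReal ((c * c) ^ 2) * ‖fderiv ℝ biaxProfile (c • x)‖ₑ ^ 2 := by
    intro x
    rw [fderiv_blobSlice, enorm_smul, mul_pow, Real.enorm_eq_ofReal (mul_self_nonneg c),
      ENNReal.ofReal_pow (mul_self_nonneg c)]
  simp_rw [h1]
  rw [lintegral_const_mul' _ _ ENNReal.ofReal_ne_top,
    HomSobolevSymmetry.lintegral_comp_smul (fun x => ‖fderiv ℝ biaxProfile x‖ₑ ^ 2) hc, ← mul_assoc,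
    ← ENNReal.ofReal_mul (by positivity)]
  congr 2
  field_simp

/-- The energy of the witness is finite at every time before the collapse. [folklore] -/
theorem blob_energy_lt_top {t : ℝ} (ht : t < 1) : ∫⁻ x, ‖blob t x‖ₑ ^ 2 < ⊤ := by
  rw [blob, lintegral_blobSlice_sq (rate_pos ht)]
  exact ENNReal.mul_lt_top ENNReal.ofReal_lt_top lintegral_biaxProfile_sq_lt_top

/-- **The energy of the witness is non-increasing** (`= √(1−t) ∫|U|²`). [folklore] -/
theorem blob_energy_antitone {s t : ℝ} (ht : t < 1) (hst : s ≤ t) :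
    ∫⁻ x, ‖blob t x‖ₑ ^ 2 ≤ ∫⁻ x, ‖blob s x‖ₑ ^ 2 := by
  rw [blob, blob, lintegral_blobSlice_sq (rate_pos ht), lintegral_blobSlice_sq (rate_pos (hst.trans_lt ht)),
    rate_inv, rate_inv]
  gcongr

/-- `∫₀¹ λ(t) dt < ∞` (`λ = (1 − t)^{-1/2}` is integrable at `1⁻`). [folklore] -/
theorem lintegral_rate_lt_top : ∫⁻ t in Ioo (0 : ℝ) 1, ENNReal.ofReal (rate t) < ⊤ := by
  have h1 : IntervalIntegrable (fun x : ℝ => x ^ (-(2⁻¹ : ℝ))) volume 1 0 :=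
    intervalIntegral.intervalIntegrable_rpow' (by norm_num)
  have h2 := h1.comp_sub_left 1
  rw [sub_self, sub_zero] at h2
  have h3 : IntegrableOn (fun x : ℝ => (1 - x) ^ (-(2⁻¹ : ℝ))) (Ioo 0 1) :=
    (intervalIntegrable_iff_integrableOn_Ioo_of_le zero_le_one).1 h2
  have h4 := h3.lintegral_lt_top
  refine lt_of_le_of_lt (le_of_eq (setLIntegral_congr_fun measurableSet_Ioo fun t ht => ?_)) h4
  rw [rate, Real.sqrt_eq_rpow, one_div, Real.rpow_neg (by linarith [ht.2])]

/-- **The total dissipation of the witness is finite** (`= ∫₀¹ λ · ∫|∇U|² = 2∫|∇U|²`). [folklore] -/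
theorem blob_dissipation_lt_top :
    ∫⁻ t in Ioo (0 : ℝ) 1, ∫⁻ x, ‖fderiv ℝ (blob t) x‖ₑ ^ 2 < ⊤ := by
  have h1 : ∀ t ∈ Ioo (0 : ℝ) 1, ∫⁻ x, ‖fderiv ℝ (blob t) x‖ₑ ^ 2 =
      ENNReal.ofReal (rate t) * ∫⁻ x, ‖fderiv ℝ biaxProfile x‖ₑ ^ 2 :=
    fun t ht => lintegral_fderiv_blobSlice_sq (rate_pos ht.2)
  rw [setLIntegral_congr_fun measurableSet_Ioo h1, lintegral_mul_const' _ _ lintegral_fderiv_biaxProfile_sq_lt_top.ne]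
  exact ENNReal.mul_lt_top lintegral_rate_lt_top lintegral_fderiv_biaxProfile_sq_lt_top

/-- **The witness blows up at the Type-I (self-similar) rate**: `‖u(t,x)‖ ≤ ‖U‖_∞ / √(1 − t)`. [folklore] -/
theorem blob_typeI : ∃ M : ℝ, ∀ t ∈ Ico (0 : ℝ) 1, ∀ x, ‖blob t x‖ ≤ M / Real.sqrt (1 - t) := by
  obtain ⟨C, hC⟩ := exists_bound_biaxProfile
  refine ⟨C, fun t ht x => ?_⟩
  show ‖rate t • biaxProfile (rate t • x)‖ ≤ C / Real.sqrt (1 - t)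
  rw [norm_smul, Real.norm_eq_abs, abs_of_pos (rate_pos ht.2), rate, div_eq_mul_inv, mul_comm]
  exact mul_le_mul_of_nonneg_right (hC _) (inv_nonneg.2 (Real.sqrt_nonneg _))

/-! ### §5 · The critical norm: the witness lies in the ESS class `L^∞_t L³_x` -/

/-- **The critical norm of the slices is scale invariant**: `∫ |c U(c x)|³ dx = ∫ |U|³` (`c > 0`).
[folklore] -/
theorem lintegral_blobSlice_cube {c : ℝ} (hc : 0 < c) :
    ∫⁻ x, ‖blobSlice c x‖ₑ ^ 3 = ∫⁻ x, ‖biaxProfile x‖ₑ ^ 3 := by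
  have h1 : ∀ x, ‖blobSlice c x‖ₑ ^ 3 = ENNReal.ofReal (c ^ 3) * ‖biaxProfile (c • x)‖ₑ ^ 3 := by
    intro x
    rw [blobSlice, enorm_smul, mul_pow, Real.enorm_eq_ofReal hc.le, ENNReal.ofReal_pow hc.le]
  simp_rw [h1]
  rw [lintegral_const_mul' _ _ ENNReal.ofReal_ne_top,
    HomSobolevSymmetry.lintegral_comp_smul (fun x => ‖biaxProfile x‖ₑ ^ 3) hc, ← mul_assoc,
    ← ENNReal.ofReal_mul (by positivity), mul_inv_cancel₀ (by positivity), ENNReal.ofReal_one,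
    one_mul]

/-- The profile has finite critical norm `∫ |U|³ < ∞`. [folklore] -/
theorem lintegral_biaxProfile_cube_lt_top :
    ∫⁻ x, ‖biaxProfile x‖ₑ ^ 3 < ⊤ := by
  have h : MemLp biaxProfile 3 (volume : Measure (EuclideanSpace ℝ (Fin 3))) :=
    (contDiff_biaxProfile (n := 0)).continuous.memLp_of_hasCompactSupport hasCompactSupport_biaxProfile
  have := lintegral_rpow_enorm_lt_top_of_eLpNorm_lt_top (by norm_num) ENNReal.ofNat_ne_top
    h.eLpNorm_lt_top
  simpa [ENNReal.toReal_ofNat] using this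

/-- **The witness stays bounded in the critical space `L³`** (the Escauriaza–Seregin–Šverák class
`L^∞_t L³_x`): `∫ |u(t)|³ = ∫ |U|³` for all `t < 1`. [folklore] -/
theorem blob_critical :
    ∃ C : ℝ≥0∞, C < ⊤ ∧ ∀ t ∈ Ico (0 : ℝ) 1, ∫⁻ x, ‖blob t x‖ₑ ^ 3 ≤ C :=
  ⟨∫⁻ x, ‖biaxProfile x‖ₑ ^ 3, lintegral_biaxProfile_cube_lt_top, fun t ht =>
    (lintegral_blobSlice_cube (c := rate t) (rate_pos ht.2)).le⟩

/-! ### §5 · The fast biaxial core: where the min–max clause forces `m ≥ λ²` -/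

/-- Centre `(2c)⁻¹ e₀` of the core ball at dilation `c`. -/
def coreCentre (c : ℝ) : EuclideanSpace ℝ (Fin 3) := (2⁻¹ * c⁻¹) • ex

/-- `‖(2c)⁻¹ e₀‖ = (2c)⁻¹`. [folklore] -/
theorem norm_coreCentre {c : ℝ} (hc : 0 < c) : ‖coreCentre c‖ = 2⁻¹ * c⁻¹ := by
  rw [coreCentre, norm_smul, Real.norm_eq_abs, abs_of_pos (by positivity)]
  simp [ex]

/-- Points of the core ball `B((2c)⁻¹e₀, (4c)⁻¹)` satisfy `(4c)⁻¹ < ‖y‖ < c⁻¹`. [folklore] -/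
theorem norm_bounds_of_mem_core {c : ℝ} (hc : 0 < c) {y : EuclideanSpace ℝ (Fin 3)}
    (hy : y ∈ ball (coreCentre c) (4⁻¹ * c⁻¹)) : 4⁻¹ * c⁻¹ < ‖y‖ ∧ ‖y‖ < c⁻¹ := by
  have h1 : ‖y - coreCentre c‖ < 4⁻¹ * c⁻¹ := by rwa [mem_ball, dist_eq_norm] at hy
  have h2 := norm_coreCentre hc
  have h3 : ‖coreCentre c‖ - ‖y‖ ≤ ‖y - coreCentre c‖ := by
    rw [norm_sub_rev]; exact norm_sub_norm_le _ _
  have h4 : ‖y‖ ≤ ‖coreCentre c‖ + ‖y - coreCentre c‖ := norm_le_insert' _ _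
  have h5 : 0 < c⁻¹ := inv_pos.2 hc
  constructor <;> nlinarith

/-- **On `B(0, c⁻¹)` the slice is the linear map `c² B`** (there `c x` lies in the unit ball, where
`U = B`). [folklore] -/
theorem blobSlice_eq_of_norm_lt {c : ℝ} (hc : 0 < c) {y : EuclideanSpace ℝ (Fin 3)} (hy : ‖y‖ < c⁻¹) :
    blobSlice c y = ((c * c) • strainB) y := by
  have h1 : c • y ∈ ball (0 : EuclideanSpace ℝ (Fin 3)) 1 := by
    rw [mem_ball_zero_iff, norm_smul, Real.norm_eq_abs, abs_of_pos hc]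
    calc c * ‖y‖ < c * c⁻¹ := mul_lt_mul_of_pos_left hy hc
      _ = 1 := mul_inv_cancel₀ hc.ne'
  show c • biaxProfile (c • y) = (c * c) • strainB y
  rw [biaxProfile_of_mem_ball h1, map_smul, smul_smul]

/-- `∇(slice) = c² B` on `B(0, c⁻¹)`. [folklore] -/
theorem fderiv_blobSlice_of_norm_lt {c : ℝ} (hc : 0 < c) {y : EuclideanSpace ℝ (Fin 3)}
    (hy : ‖y‖ < c⁻¹) : fderiv ℝ (blobSlice c) y = (c * c) • strainB := by
  have h : blobSlice c =ᶠ[𝓝 y] ⇑((c * c) • strainB) := by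
    have ho : IsOpen {z : EuclideanSpace ℝ (Fin 3) | ‖z‖ < c⁻¹} := isOpen_lt continuous_norm continuous_const
    filter_upwards [ho.mem_nhds hy] with z hz
    exact blobSlice_eq_of_norm_lt hc hz
  rw [h.fderiv_eq, ContinuousLinearMap.fderiv]

/-- **The core is fast**: for `4l ≤ c`, every point of the core ball has speed `> l`
(`|c² B y| ≥ c²‖y‖ > c²(4c)⁻¹ = c/4 ≥ l`). [folklore] -/
theorem core_fast {c l : ℝ} (hc : 0 < c) (hcl : 4 * l ≤ c) {y : EuclideanSpace ℝ (Fin 3)}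
    (hy : y ∈ ball (coreCentre c) (4⁻¹ * c⁻¹)) : l < ‖blobSlice c y‖ := by
  obtain ⟨h1, h2⟩ := norm_bounds_of_mem_core hc hy
  rw [blobSlice_eq_of_norm_lt hc h2]
  show l < ‖(c * c) • strainB y‖
  rw [norm_smul, Real.norm_eq_abs, abs_of_pos (mul_pos hc hc)]
  calc l ≤ c * 4⁻¹ := by linarith
    _ = (c * c) * (4⁻¹ * c⁻¹) := by field_simp
    _ < (c * c) * ‖y‖ := mul_lt_mul_of_pos_left h1 (mul_pos hc hc)
    _ ≤ (c * c) * ‖strainB y‖ := mul_le_mul_of_nonneg_left (norm_le_norm_strainB y) (mul_pos hc hc).le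

/-- **The min–max clause forces `m ≥ c²` on the core** (the middle eigenvalue of `c² diag(1,1,−2)` is
`+c²`: `le_of_plane`). [folklore] -/
theorem core_le_majorant {c m : ℝ} (hc : 0 < c) {y : EuclideanSpace ℝ (Fin 3)}
    (hy : y ∈ ball (coreCentre c) (4⁻¹ * c⁻¹))
    (h : ∃ v w : EuclideanSpace ℝ (Fin 3), ‖v‖ = 1 ∧ ‖w‖ = 1 ∧ ⟪v, w⟫ = 0 ∧
      ∀ α β : ℝ, ⟪fderiv ℝ (blobSlice c) y (α • v + β • w), α • v + β • w⟫ ≤ m * (α ^ 2 + β ^ 2)) :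
    c * c ≤ m := by
  rw [fderiv_blobSlice_of_norm_lt hc (norm_bounds_of_mem_core hc hy).2, ← fderiv_biaxVel (c * c) y] at h
  exact le_of_plane h

/-- **Lower bound on the fast-class integral of any admissible majorant** at dilation `c ≥ 4l`:
`(c²)^q · |core ball| ≤ ∫_{|slice| > l} m^q`. [folklore] -/
theorem core_inner_lower {c l q : ℝ} (hc : 0 < c) (hcl : 4 * l ≤ c) (hq : 0 ≤ q)
    {μ : EuclideanSpace ℝ (Fin 3) → ℝ}
    (hμ : ∀ y, l < ‖blobSlice c y‖ → ∃ v w : EuclideanSpace ℝ (Fin 3), ‖v‖ = 1 ∧ ‖w‖ = 1 ∧ ⟪v, w⟫ = 0 ∧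
      ∀ α β : ℝ, ⟪fderiv ℝ (blobSlice c) y (α • v + β • w), α • v + β • w⟫ ≤ μ y * (α ^ 2 + β ^ 2)) :
    ENNReal.ofReal (c * c) ^ q * volume (ball (coreCentre c) (4⁻¹ * c⁻¹)) ≤
      ∫⁻ y in {y : EuclideanSpace ℝ (Fin 3) | l < ‖blobSlice c y‖}, ENNReal.ofReal (μ y) ^ q := by
  calc ENNReal.ofReal (c * c) ^ q * volume (ball (coreCentre c) (4⁻¹ * c⁻¹))
      = ∫⁻ _ in ball (coreCentre c) (4⁻¹ * c⁻¹), ENNReal.ofReal (c * c) ^ q := (setLIntegral_const _ _).symm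
    _ ≤ ∫⁻ y in ball (coreCentre c) (4⁻¹ * c⁻¹), ENNReal.ofReal (μ y) ^ q :=
        setLIntegral_mono' measurableSet_ball fun y hy =>
          ENNReal.rpow_le_rpow
            (ENNReal.ofReal_le_ofReal (core_le_majorant hc hy (hμ y (core_fast hc hcl hy)))) hq
    _ ≤ _ := lintegral_mono_set fun y hy => core_fast hc hcl hy

/-- The exponent bookkeeping `(2q − 3) · 2/(2q−3) = 2` behind the log-divergence at the
self-similar rate: `((c²)^q (4⁻¹c⁻¹)³)^{2/(2q−3)} = c² · (4⁻³)^{2/(2q−3)}`. [folklore] -/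
theorem real_core_identity {c q : ℝ} (hc : 0 < c) (hq : 3 / 2 < q) :
    ((c * c) ^ q * (4⁻¹ * c⁻¹) ^ 3) ^ (2 / (2 * q - 3)) =
      c ^ 2 * ((4 : ℝ)⁻¹ ^ 3) ^ (2 / (2 * q - 3)) := by
  have hq3 : (2 * q - 3) ≠ 0 := by linarith
  have h1 : (c * c) ^ q = c ^ (2 * q) := by
    rw [← sq, ← Real.rpow_natCast c 2, ← Real.rpow_mul hc.le]
    norm_num
  have h2 : (4⁻¹ * c⁻¹ : ℝ) ^ 3 = (4 : ℝ)⁻¹ ^ 3 * c ^ (-(3 : ℝ)) := by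
    have aux : c ^ (3 : ℝ) = c ^ (3 : ℕ) := by exact_mod_cast Real.rpow_natCast c 3
    rw [mul_pow, Real.rpow_neg hc.le, aux, inv_pow, inv_pow]
  have h3 : c ^ (2 * q) * ((4 : ℝ)⁻¹ ^ 3 * c ^ (-(3 : ℝ))) = (4 : ℝ)⁻¹ ^ 3 * c ^ (2 * q - 3) := by
    rw [mul_left_comm, ← Real.rpow_add hc]
    ring_nf
  have h4 : (c ^ (2 * q - 3)) ^ (2 / (2 * q - 3)) = c ^ 2 := by
    have h5 : (2 * q - 3) * (2 / (2 * q - 3)) = 2 := by field_simp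
    rw [← Real.rpow_mul hc.le, h5, Real.rpow_two]
  rw [h1, h2, h3, Real.mul_rpow (by positivity) (Real.rpow_nonneg hc.le _), h4, mul_comm]

/-- **The `2/(2q−3)`-th power of the core lower bound is `λ² ×` a positive constant**:
`((c²)^q |B((2c)⁻¹e₀,(4c)⁻¹)|)^{2/(2q−3)} = c² · ((4⁻³) |B₁|)^{2/(2q−3)}`. [folklore] -/
theorem core_rpow_identity {c q : ℝ} (hc : 0 < c) (hq : 3 / 2 < q) :
    (ENNReal.ofReal (c * c) ^ q * volume (ball (coreCentre c) (4⁻¹ * c⁻¹))) ^ (2 / (2 * q - 3)) =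
      ENNReal.ofReal (c ^ 2) *
        (ENNReal.ofReal ((4 : ℝ)⁻¹ ^ 3) * volume (ball (0 : EuclideanSpace ℝ (Fin 3)) 1)) ^
          (2 / (2 * q - 3)) := by
  have he : 0 ≤ 2 / (2 * q - 3) := (div_pos two_pos (by linarith)).le
  have hcq : 0 ≤ (c * c) ^ q := Real.rpow_nonneg (mul_self_nonneg c) _
  have h4 : (0 : ℝ) ≤ (4⁻¹ * c⁻¹) ^ 3 := by positivity
  have hA : (ENNReal.ofReal (c * c) ^ q) ^ (2 / (2 * q - 3)) *
      ENNReal.ofReal ((4⁻¹ * c⁻¹) ^ 3) ^ (2 / (2 * q - 3)) =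
      ENNReal.ofReal (c ^ 2) * ENNReal.ofReal ((4 : ℝ)⁻¹ ^ 3) ^ (2 / (2 * q - 3)) := by
    rw [ENNReal.ofReal_rpow_of_pos (mul_pos hc hc), ENNReal.ofReal_rpow_of_nonneg hcq he,
      ENNReal.ofReal_rpow_of_nonneg h4 he, ← ENNReal.ofReal_mul (Real.rpow_nonneg hcq _),
      ← Real.mul_rpow hcq h4, real_core_identity hc hq, ENNReal.ofReal_mul (sq_nonneg c),
      ENNReal.ofReal_rpow_of_nonneg (by positivity) he]
  rw [Measure.addHaar_ball volume (coreCentre c) (by positivity : (0 : ℝ) ≤ 4⁻¹ * c⁻¹),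
    finrank_euclideanSpace_fin, ← mul_assoc, ENNReal.mul_rpow_of_nonneg _ _ he,
    ENNReal.mul_rpow_of_nonneg _ _ he, hA, ENNReal.mul_rpow_of_nonneg _ _ he, mul_assoc]

/-- **`∫ₐ¹ dt/(1 − t) = ∞`** (`a < 1`): the logarithmic divergence at the collapse time
(Mathlib: `(t − 1)⁻¹` is not interval integrable across `1`). [folklore] -/
theorem lintegral_inv_one_sub_eq_top {a : ℝ} (ha : a < 1) :
    ∫⁻ t in Ioo a 1, ENNReal.ofReal ((1 - t)⁻¹) = ⊤ := by
  have hni : ¬ IntegrableOn (fun t : ℝ => (t - 1)⁻¹) (Ioo a 1) := by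
    intro h
    have h2 : IntervalIntegrable (fun t : ℝ => (t - 1)⁻¹) volume a 1 :=
      (intervalIntegrable_iff_integrableOn_Ioo_of_le ha.le).2 h
    rw [intervalIntegrable_sub_inv_iff] at h2
    rcases h2 with h2 | h2
    · exact absurd h2 ha.ne
    · exact h2 right_mem_uIcc
  have hmeas : AEStronglyMeasurable (fun t : ℝ => (t - 1)⁻¹) (volume.restrict (Ioo a 1)) :=
    ((measurable_id.sub_const 1).inv).aestronglyMeasurable
  have htop : ∫⁻ t in Ioo a 1, ‖(t - 1)⁻¹‖ₑ = ⊤ := by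
    by_contra hne
    exact hni ⟨hmeas, lt_top_iff_ne_top.2 hne⟩
  rw [← htop]
  refine setLIntegral_congr_fun measurableSet_Ioo fun t ht => ?_
  rw [Real.enorm_eq_ofReal_abs, abs_inv, abs_of_neg (by linarith [ht.2]), neg_sub]

/-! ### §5 · The conclusion of `FastClassSqueeze` is not kinematic -/

/-- **`FastClassSqueeze` does not follow from smoothness, incompressibility, the energy class (finite,
non-increasing energy, finite total dissipation), the Type-I rate and a bounded critical norm
`sup_t ∫|u(t)|³ < ∞` (the Escauriaza–Seregin–Šverák class).** The conclusion of the crux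
— a level `l > 0`, an exponent `q > 3/2` and a nonnegative min–max majorant `m` of the middle strain
eigenvalue on the fast class with `∫₀ᵀ (∫_{|u|>l} m^q)^{2/(2q−3)} < ∞` — FAILS for the
self-similar-rate collapsing blob `u(t,x) = λU(λx)`, `λ = (1−t)^{-1/2}`, `U = curl(χ A)` (smooth,
compactly supported, divergence free, `= diag(1,1,−2)x` on the unit ball): its energy is
`√(1−t) ∫|U|²` (decreasing), its dissipation `∫₀¹ λ ∫|∇U|² < ∞`, its speed `≤ ‖U‖_∞ (1−t)^{-1/2}`,
but on the fast biaxial core `B((2λ)⁻¹e₀, (4λ)⁻¹)` (speed `> l` once `λ ≥ 4l`) the min–max clause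
forces `m ≥ λ²`, so the time integrand is `≥ K λ² = K/(1 − t)` with `K > 0`, and `∫ dt/(1−t) = ∞`.
Hence any proof of the crux must use the momentum equation beyond the energy inequality, and must
exclude exactly the FAST BIAXIAL TYPE-I collapse; the self-similar rate is the first (logarithmically)
divergent one. [folklore] -/
theorem fastClassSqueeze_false_kinematic :
    ¬ (∀ (T : ℝ), 0 < T →
      ∀ (u : ℝ → EuclideanSpace ℝ (Fin 3) → EuclideanSpace ℝ (Fin 3)),
        IsSmoothSpaceTimeOn (Set.Ico 0 T) u →
        (∀ t ∈ Set.Ico 0 T, VectorCalculus.IsDivFree (u t)) →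
        (∀ t ∈ Set.Ico 0 T, HasCompactSupport (u t)) →
        (∀ t ∈ Set.Ico 0 T, ∫⁻ x, ‖u t x‖ₑ ^ 2 < ⊤) →
        (∀ s ∈ Set.Ico 0 T, ∀ t ∈ Set.Ico 0 T, s ≤ t → ∫⁻ x, ‖u t x‖ₑ ^ 2 ≤ ∫⁻ x, ‖u s x‖ₑ ^ 2) →
        (∫⁻ t in Set.Ioo 0 T, ∫⁻ x, ‖fderiv ℝ (u t) x‖ₑ ^ 2 < ⊤) →
        (∃ M : ℝ, ∀ t ∈ Set.Ico 0 T, ∀ x, ‖u t x‖ ≤ M / Real.sqrt (T - t)) →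
        (∃ C : ℝ≥0∞, C < ⊤ ∧ ∀ t ∈ Set.Ico 0 T, ∫⁻ x, ‖u t x‖ₑ ^ 3 ≤ C) →
        ∃ l : ℝ, 0 < l ∧ ∃ q : ℝ, 3 / 2 < q ∧ ∃ m : ℝ → EuclideanSpace ℝ (Fin 3) → ℝ,
          (∀ t x, 0 ≤ m t x) ∧
          (∀ t ∈ Set.Ico 0 T, ∀ x, l < ‖u t x‖ → ∃ v w : EuclideanSpace ℝ (Fin 3),
            ‖v‖ = 1 ∧ ‖w‖ = 1 ∧ inner ℝ v w = 0 ∧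
            ∀ α β : ℝ, inner ℝ (fderiv ℝ (u t) x (α • v + β • w)) (α • v + β • w) ≤
              m t x * (α ^ 2 + β ^ 2)) ∧
          ∫⁻ t in Set.Ioo 0 T, (∫⁻ x in {x : EuclideanSpace ℝ (Fin 3) | l < ‖u t x‖},
            ENNReal.ofReal (m t x) ^ q) ^ (2 / (2 * q - 3)) < ⊤) := by
  intro h
  obtain ⟨l, -, q, hq, m, -, hplane, hint⟩ := h 1 one_pos blob blob_isSmoothSpaceTimeOn
    (fun t _ => blob_isDivFree t) (fun t ht => blob_hasCompactSupport ht.2)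
    (fun t ht => blob_energy_lt_top ht.2) (fun s _ t ht hst => blob_energy_antitone ht.2 hst)
    blob_dissipation_lt_top blob_typeI blob_critical
  have he : 0 < 2 / (2 * q - 3) := div_pos two_pos (by linarith)
  have hq0 : 0 ≤ q := by linarith
  -- the threshold time `t₀`: for `t > t₀`, `λ(t) ≥ R := max (4l) 1`
  set R : ℝ := max (4 * l) 1 with hR
  have hR1 : 1 ≤ R := le_max_right _ _
  have hR0 : 0 < R := by linarith
  set t₀ : ℝ := 1 - (R ^ 2)⁻¹ with ht₀
  have ht₀0 : 0 ≤ t₀ := by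
    have : (R ^ 2)⁻¹ ≤ 1 := inv_le_one_of_one_le₀ (by nlinarith)
    linarith
  have ht₀1 : t₀ < 1 := by
    have : 0 < (R ^ 2)⁻¹ := by positivity
    linarith
  have hrate : ∀ t ∈ Ioo t₀ 1, R ≤ rate t := by
    intro t ht
    have h1t : 0 < 1 - t := by linarith [ht.2]
    have h2 : 1 - t ≤ (R ^ 2)⁻¹ := by linarith [ht.1]
    have h3 : Real.sqrt (1 - t) ≤ R⁻¹ :=
      (Real.sqrt_le_sqrt h2).trans_eq (by rw [← inv_pow, Real.sqrt_sq (inv_nonneg.2 hR0.le)])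
    calc R = (R⁻¹)⁻¹ := (inv_inv R).symm
      _ ≤ (Real.sqrt (1 - t))⁻¹ := inv_anti₀ (Real.sqrt_pos.2 h1t) h3
  -- the positive constant `K` and the pointwise lower bound `K/(1−t)` of the time integrand
  set K : ℝ≥0∞ := (ENNReal.ofReal ((4 : ℝ)⁻¹ ^ 3) * volume (ball (0 : EuclideanSpace ℝ (Fin 3)) 1)) ^
    (2 / (2 * q - 3)) with hK
  have hB0 : ENNReal.ofReal ((4 : ℝ)⁻¹ ^ 3) * volume (ball (0 : EuclideanSpace ℝ (Fin 3)) 1) ≠ 0 :=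
    mul_ne_zero (ENNReal.ofReal_pos.2 (by positivity)).ne' (measure_ball_pos volume _ one_pos).ne'
  have hBtop : ENNReal.ofReal ((4 : ℝ)⁻¹ ^ 3) * volume (ball (0 : EuclideanSpace ℝ (Fin 3)) 1) ≠ ⊤ :=
    ENNReal.mul_ne_top ENNReal.ofReal_ne_top measure_ball_lt_top.ne
  have hK0 : K ≠ 0 := (ENNReal.rpow_pos (pos_iff_ne_zero.2 hB0) hBtop).ne'
  have hKtop : K ≠ ⊤ := ENNReal.rpow_ne_top_of_nonneg he.le hBtop
  have hG : ∀ t ∈ Ioo t₀ 1, ENNReal.ofReal ((1 - t)⁻¹) * K ≤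
      (∫⁻ x in {x : EuclideanSpace ℝ (Fin 3) | l < ‖blob t x‖}, ENNReal.ofReal (m t x) ^ q) ^
        (2 / (2 * q - 3)) := by
    intro t ht
    have ht1 : t < 1 := ht.2
    have hc : 0 < rate t := rate_pos ht1
    have hcl : 4 * l ≤ rate t := (le_max_left _ _).trans (hrate t ht)
    have h1 := core_inner_lower hc hcl hq0 (μ := m t)
      (fun y hy => hplane t ⟨ht₀0.trans ht.1.le, ht1⟩ y hy)
    have h2 := ENNReal.rpow_le_rpow h1 he.le
    rw [core_rpow_identity hc hq, rate_sq ht1] at h2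
    exact h2
  -- integrate: `∫_{t₀}^1 K/(1−t) dt = ∞`
  have hI : ∫⁻ t in Ioo t₀ 1, ENNReal.ofReal ((1 - t)⁻¹) * K = ⊤ := by
    rw [lintegral_mul_const' _ _ hKtop, lintegral_inv_one_sub_eq_top ht₀1, ENNReal.top_mul hK0]
  have h3 := (setLIntegral_mono' measurableSet_Ioo hG).trans
    (lintegral_mono_set (μ := volume) (Ioo_subset_Ioo_left ht₀0))
  rw [hI, top_le_iff] at h3
  exact (lt_top_iff_ne_top.1 hint) h3

/-! ### §5 · Corollary for the BC2 split: `FastGradientSerrinStarved` (X₂) is not kinematic either -/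

/-- The operator norm majorises the quadratic form of `∇(slice)` on every 2-plane (Cauchy–Schwarz on
the frame `e₀, e₁`): the min–max clause of the crux holds with `m := ‖∇u‖`. [folklore] -/
theorem opNorm_plane_majorant (L : EuclideanSpace ℝ (Fin 3) →L[ℝ] EuclideanSpace ℝ (Fin 3)) :
    ∃ v w : EuclideanSpace ℝ (Fin 3), ‖v‖ = 1 ∧ ‖w‖ = 1 ∧ ⟪v, w⟫ = 0 ∧
      ∀ α β : ℝ, ⟪L (α • v + β • w), α • v + β • w⟫ ≤ ‖L‖ * (α ^ 2 + β ^ 2) := by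
  refine ⟨ex, ey, by simp [ex], by simp [ey], inner_ex_ey, fun α β => ?_⟩
  calc ⟪L (α • ex + β • ey), α • ex + β • ey⟫
      ≤ ‖L (α • ex + β • ey)‖ * ‖α • ex + β • ey‖ := real_inner_le_norm _ _
    _ ≤ ‖L‖ * ‖α • ex + β • ey‖ * ‖α • ex + β • ey‖ := by
        gcongr
        exact L.le_opNorm _
    _ = ‖L‖ * (α ^ 2 + β ^ 2) := by rw [mul_assoc, ← sq, norm_combo_sq]

/-- **The blob is energy-starved at infinite speed** (it satisfies the conclusion of
`NoFastEnergyConcentration`, X₁): for every `ε > 0` some level `l` bounds the fast-class energy by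
`ε` at ALL times — near the collapse the TOTAL energy `√(1−t)∫|U|²` is already `≤ ε`, before that the
field is bounded and the fast class above that bound is empty. [folklore] -/
theorem blob_noFastEnergyConcentration {ε : ℝ} (hε : 0 < ε) :
    ∃ l : ℝ, 0 < l ∧ ∀ t ∈ Ico (0 : ℝ) 1,
      ∫⁻ x in {x : EuclideanSpace ℝ (Fin 3) | l < ‖blob t x‖}, ‖blob t x‖ₑ ^ 2 ≤ ENNReal.ofReal ε := by
  obtain ⟨M, hM⟩ := blob_typeI
  set E : ℝ≥0∞ := ∫⁻ x, ‖biaxProfile x‖ₑ ^ 2 with hE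
  have hEtop : E ≠ ⊤ := lintegral_biaxProfile_sq_lt_top.ne
  set Er : ℝ := E.toReal with hEr
  have hEr0 : 0 ≤ Er := ENNReal.toReal_nonneg
  -- the late window `[t₁, 1)`: total energy `≤ ε`
  set δ : ℝ := ε / (Er + 1) with hδ
  have hδ0 : 0 < δ := div_pos hε (by linarith)
  set t₁ : ℝ := max 0 (1 - δ ^ 2) with ht₁
  have ht₁0 : 0 ≤ t₁ := le_max_left _ _
  have ht₁1 : t₁ < 1 := max_lt one_pos (by nlinarith)
  -- the early window `[0, t₁)`: the field is bounded by `L`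
  set L : ℝ := |M| / Real.sqrt (1 - t₁) with hL
  have hsq1 : 0 < Real.sqrt (1 - t₁) := Real.sqrt_pos.2 (by linarith)
  refine ⟨max L 1, lt_max_of_lt_right one_pos, fun t ht => ?_⟩
  rcases lt_or_ge t t₁ with htt | htt
  · -- early: the fast class is empty
    have hempty : {x : EuclideanSpace ℝ (Fin 3) | max L 1 < ‖blob t x‖} = ∅ := by
      refine Set.eq_empty_of_forall_notMem fun x hx => ?_
      have h1 : ‖blob t x‖ ≤ M / Real.sqrt (1 - t) := hM t ht x
      have h2 : M / Real.sqrt (1 - t) ≤ L := by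
        have hst : Real.sqrt (1 - t₁) ≤ Real.sqrt (1 - t) := Real.sqrt_le_sqrt (by linarith)
        calc M / Real.sqrt (1 - t) ≤ |M| / Real.sqrt (1 - t) :=
              div_le_div_of_nonneg_right (le_abs_self M) (hsq1.trans_le hst).le
          _ ≤ |M| / Real.sqrt (1 - t₁) := div_le_div_of_nonneg_left (abs_nonneg M) hsq1 hst
      exact absurd (lt_of_le_of_lt (le_max_left L 1) hx) (not_lt.2 (h1.trans h2))
    rw [hempty, Measure.restrict_empty, lintegral_zero_measure]
    exact bot_le
  · -- late: bound by the total energy `√(1−t) E ≤ δ (Er + 1) = ε`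
    have ht1 : t < 1 := ht.2
    have hδt : Real.sqrt (1 - t) ≤ δ := by
      have h1 : 1 - t ≤ δ ^ 2 := by
        have : 1 - δ ^ 2 ≤ t₁ := le_max_right _ _
        linarith
      calc Real.sqrt (1 - t) ≤ Real.sqrt (δ ^ 2) := Real.sqrt_le_sqrt h1
        _ = δ := Real.sqrt_sq hδ0.le
    calc ∫⁻ x in {x : EuclideanSpace ℝ (Fin 3) | max L 1 < ‖blob t x‖}, ‖blob t x‖ₑ ^ 2
        ≤ ∫⁻ x, ‖blob t x‖ₑ ^ 2 := setLIntegral_le_lintegral _ _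
      _ = ENNReal.ofReal (Real.sqrt (1 - t)) * E := by
          rw [blob, lintegral_blobSlice_sq (rate_pos ht1), rate_inv]
      _ ≤ ENNReal.ofReal δ * ENNReal.ofReal Er := by
          rw [ENNReal.ofReal_toReal hEtop]
          exact mul_le_mul_of_nonneg_right (ENNReal.ofReal_le_ofReal hδt) bot_le
      _ = ENNReal.ofReal (δ * Er) := (ENNReal.ofReal_mul hδ0.le).symm
      _ ≤ ENNReal.ofReal ε := ENNReal.ofReal_le_ofReal (by
          rw [hδ, div_mul_eq_mul_div, div_le_iff₀ (by linarith)]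
          nlinarith)

/-- **`FastGradientSerrinStarved` (X₂ of the BC2 split) is not kinematic either, even GIVEN the
conclusion of `NoFastEnergyConcentration` (X₁) for the same field**: the blob is energy-starved at
infinite speed (`blob_noFastEnergyConcentration`), smooth, divergence free, compactly supported, in
the energy class with non-increasing energy and finite dissipation, Type-I, bounded in `L³`, yet its
fast-class GRADIENT Serrin functional `∫₀¹(∫_{|u|>l}‖∇u‖^q)^{2/(2q−3)}` is infinite for every `l > 0`,
`q > 3/2` (`‖∇u‖ = λ²‖B‖ ≥ λ²` on the fast biaxial core). So X₂, not X₁, carries the regularity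
strength of the crux, and its proof must be dynamic. [folklore] -/
theorem fastGradientSerrinStarved_false_kinematic :
    ¬ (∀ (T : ℝ), 0 < T →
      ∀ (u : ℝ → EuclideanSpace ℝ (Fin 3) → EuclideanSpace ℝ (Fin 3)),
        IsSmoothSpaceTimeOn (Set.Ico 0 T) u →
        (∀ t ∈ Set.Ico 0 T, VectorCalculus.IsDivFree (u t)) →
        (∀ t ∈ Set.Ico 0 T, HasCompactSupport (u t)) →
        (∀ t ∈ Set.Ico 0 T, ∫⁻ x, ‖u t x‖ₑ ^ 2 < ⊤) →
        (∀ s ∈ Set.Ico 0 T, ∀ t ∈ Set.Ico 0 T, s ≤ t → ∫⁻ x, ‖u t x‖ₑ ^ 2 ≤ ∫⁻ x, ‖u s x‖ₑ ^ 2) →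
        (∫⁻ t in Set.Ioo 0 T, ∫⁻ x, ‖fderiv ℝ (u t) x‖ₑ ^ 2 < ⊤) →
        (∃ M : ℝ, ∀ t ∈ Set.Ico 0 T, ∀ x, ‖u t x‖ ≤ M / Real.sqrt (T - t)) →
        (∃ C : ℝ≥0∞, C < ⊤ ∧ ∀ t ∈ Set.Ico 0 T, ∫⁻ x, ‖u t x‖ₑ ^ 3 ≤ C) →
        (∀ ε : ℝ, 0 < ε → ∃ l : ℝ, 0 < l ∧ ∀ t ∈ Set.Ico 0 T,
          ∫⁻ x in {x : EuclideanSpace ℝ (Fin 3) | l < ‖u t x‖}, ‖u t x‖ₑ ^ 2 ≤ ENNReal.ofReal ε) →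
        ∃ l : ℝ, 0 < l ∧ ∃ q : ℝ, 3 / 2 < q ∧
          ∫⁻ t in Set.Ioo 0 T, (∫⁻ x in {x : EuclideanSpace ℝ (Fin 3) | l < ‖u t x‖},
            ENNReal.ofReal ‖fderiv ℝ (u t) x‖ ^ q) ^ (2 / (2 * q - 3)) < ⊤) := by
  intro h
  obtain ⟨l, -, q, hq, hint⟩ := h 1 one_pos blob blob_isSmoothSpaceTimeOn
    (fun t _ => blob_isDivFree t) (fun t ht => blob_hasCompactSupport ht.2)
    (fun t ht => blob_energy_lt_top ht.2) (fun s _ t ht hst => blob_energy_antitone ht.2 hst)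
    blob_dissipation_lt_top blob_typeI blob_critical (fun ε hε => blob_noFastEnergyConcentration hε)
  have he : 0 < 2 / (2 * q - 3) := div_pos two_pos (by linarith)
  have hq0 : 0 ≤ q := by linarith
  set R : ℝ := max (4 * l) 1 with hR
  have hR1 : 1 ≤ R := le_max_right _ _
  have hR0 : 0 < R := by linarith
  set t₀ : ℝ := 1 - (R ^ 2)⁻¹ with ht₀
  have ht₀0 : 0 ≤ t₀ := by
    have : (R ^ 2)⁻¹ ≤ 1 := inv_le_one_of_one_le₀ (by nlinarith)
    linarith
  have ht₀1 : t₀ < 1 := by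
    have : 0 < (R ^ 2)⁻¹ := by positivity
    linarith
  have hrate : ∀ t ∈ Ioo t₀ 1, R ≤ rate t := by
    intro t ht
    have h1t : 0 < 1 - t := by linarith [ht.2]
    have h2 : 1 - t ≤ (R ^ 2)⁻¹ := by linarith [ht.1]
    have h3 : Real.sqrt (1 - t) ≤ R⁻¹ :=
      (Real.sqrt_le_sqrt h2).trans_eq (by rw [← inv_pow, Real.sqrt_sq (inv_nonneg.2 hR0.le)])
    calc R = (R⁻¹)⁻¹ := (inv_inv R).symm
      _ ≤ (Real.sqrt (1 - t))⁻¹ := inv_anti₀ (Real.sqrt_pos.2 h1t) h3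
  set K : ℝ≥0∞ := (ENNReal.ofReal ((4 : ℝ)⁻¹ ^ 3) * volume (ball (0 : EuclideanSpace ℝ (Fin 3)) 1)) ^
    (2 / (2 * q - 3)) with hK
  have hB0 : ENNReal.ofReal ((4 : ℝ)⁻¹ ^ 3) * volume (ball (0 : EuclideanSpace ℝ (Fin 3)) 1) ≠ 0 :=
    mul_ne_zero (ENNReal.ofReal_pos.2 (by positivity)).ne' (measure_ball_pos volume _ one_pos).ne'
  have hBtop : ENNReal.ofReal ((4 : ℝ)⁻¹ ^ 3) * volume (ball (0 : EuclideanSpace ℝ (Fin 3)) 1) ≠ ⊤ :=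
    ENNReal.mul_ne_top ENNReal.ofReal_ne_top measure_ball_lt_top.ne
  have hK0 : K ≠ 0 := (ENNReal.rpow_pos (pos_iff_ne_zero.2 hB0) hBtop).ne'
  have hKtop : K ≠ ⊤ := ENNReal.rpow_ne_top_of_nonneg he.le hBtop
  have hG : ∀ t ∈ Ioo t₀ 1, ENNReal.ofReal ((1 - t)⁻¹) * K ≤
      (∫⁻ x in {x : EuclideanSpace ℝ (Fin 3) | l < ‖blob t x‖},
        ENNReal.ofReal ‖fderiv ℝ (blob t) x‖ ^ q) ^ (2 / (2 * q - 3)) := by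
    intro t ht
    have ht1 : t < 1 := ht.2
    have hc : 0 < rate t := rate_pos ht1
    have hcl : 4 * l ≤ rate t := (le_max_left _ _).trans (hrate t ht)
    have h1 := core_inner_lower hc hcl hq0 (μ := fun y => ‖fderiv ℝ (blob t) y‖)
      (fun y _ => opNorm_plane_majorant (fderiv ℝ (blobSlice (rate t)) y))
    have h2 := ENNReal.rpow_le_rpow h1 he.le
    rw [core_rpow_identity hc hq, rate_sq ht1] at h2
    exact h2
  have hI : ∫⁻ t in Ioo t₀ 1, ENNReal.ofReal ((1 - t)⁻¹) * K = ⊤ := by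
    rw [lintegral_mul_const' _ _ hKtop, lintegral_inv_one_sub_eq_top ht₀1, ENNReal.top_mul hK0]
  have h3 := (setLIntegral_mono' measurableSet_Ioo hG).trans
    (lintegral_mono_set (μ := volume) (Ioo_subset_Ioo_left ht₀0))
  rw [hI, top_le_iff] at h3
  exact (lt_top_iff_ne_top.1 hint) h3

/-- **`FastClassSqueezeKinematic` is false** (named form of `fastClassSqueeze_false_kinematic`). [folklore] -/
theorem not_fastClassSqueezeKinematic : ¬ FastClassSqueezeKinematic :=
  fastClassSqueeze_false_kinematic

end Summit.NavierStokesRegularity.NavierStokesRegularity.Cruxes.FastClassSqueeze.Disproof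

end
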